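/-
Copyright: cell `langlands-arthur-audit` (papers/Langlands/langlands-arthur-audit), unit `pub-arthur-typer-g52`
(planner-pub-arthur-typer-g52-0, LEAN TYPER gen 52, 2026-08-22).  Staged for the tree under
`Literature/NumberTheory/Automorphic/Arthur2013/Leaves/` (LEAN-IN-TREE rule 2026-08-18).  Module map M209.  Imports `Mathlib` and
`HarnessLib` only (no other leaf is imported; M56 `Leaves/WeightedFL` (`TWFL`, row L09), M115/M207 `Leaves/WeightedFLPrint(2)` and the
[Mok]/[KMSW] DAG modules are referred to by name in prose only).
Sources (HOME = run/shared/lean/pub/pub-arthur/); every « … » span below is located verbatim (whitespace-normalised) in one of them by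
`HOME/pub-arthur-typer-g52/tree/build/quotecheck.py`:
[I]    = Moeglin–Waldspurger, *Stabilisation de la formule des traces tordue I: endoscopie tordue sur un corps local*, arXiv:1401.4569v1
         (bib `Waldspurger2014StabilisationI`; TeX source `HOME/inputs/files/src/1401.4569/main.tex`, locator `l.N` = line N of main.tex;
         = Progress in Math. 316 (2016), vol. 1, ch. I — the print is NOT re-read here);
[II]   = Waldspurger, *Stabilisation de la formule des traces tordue II: intégrales orbitales et endoscopie sur un corps local non-archimédien;
         définitions et énoncés des résultats*, arXiv:1401.7127v1 (bib `Waldspurger2014StabilisationII`; `HOME/inputs/files/src/1401.7127/main.tex`);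
[Mok]  = Mok, *Endoscopic classification of representations of quasi-split unitary groups*, arXiv:1206.0882 (bib `Mok2012`;
         `HOME/inputs/files/src/1206.0882/main.tex`; = Mem. AMS 235 (2015), no. 1108);
[Kt_1] = Kottwitz, *Base change for unit elements of Hecke algebras*, Compositio Math. 60 (1986) 237–250 (bib `Kottwitz1986BaseChangeUnits`;
         Numdam text layer copied by unit up-g37 under `HOME/pub-arthur-up-g37/primaries/kottwitz1986/` with SHA256SUMS: p0012 = p. 247,
         p0013 = p. 248; OCR slips inside « … » are reproduced as the text layer prints them and flagged [OCR sic]).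
Arthur's book (AMS Colloquium Publ. 61) is NOT held by the cell (acq-04129) and is not used below.
-/
import Mathlib
import HarnessLib

/-!

VERSION v1.1 (docstring-only erratum over v1 = p323930; every declaration and proof byte-identical): (a) §3 (17) `FineIdxUn` /
(20f) `endoUn₀` — `Z(M̂_U)^{Γ_F}` is `(ℂ^×)^r × {±1}` (anti-palindromic block scalars); the Bool index set is its ELLIPTIC locus
`{±1}^r × {±1}`, the remaining indices having coefficient `0` ([II] 1.10); (b) the label (D131) now sits on `Normalisation` (the three
hypotheses of §5 are hypotheses on opaque numbers); nothing else changed.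

# Arthur (2013) audit, typed leaves — the PRINCIPAL SLICE of the twisted weighted fundamental lemma ([II] Thm 4.4) at [Mok]'s local
# base-change datum `G̃_{E/F}(N) = G_{E/F}(N) ⋊ θ`, against [Kt_1] §3: the centre bookkeeping (α)/(β) of the cell's question Q-UP-61-a,
# kernel-checked in a block-scalar model, and the typed edge “TWFL principal slice ⟺ [Kt_1] §3” with its two residual hypotheses NAMED

WHY (the cell's question, GAPS G-UP-699 / G-UP-704, addressed « FOR THE TYPER »).  Row L09 of the audit (M56 `Leaves/WeightedFL`, `TWFL`) is
consumed by [Mok]/[KMSW] at the twisted datum `G̃_{E_v/F_v}(N)`, `v` inert and unramified.  Unit up-g61 asked (G-UP-699 (a)) whether the case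
« M̃′ = the principal elliptic endoscopic datum of the Levi M̃ » of [II] Thm 4.4 REDUCES there to Kottwitz's refereed 1986 unit matching, and
typed the question against [II]'s own definitions (G-UP-704): the reduction holds « GIVEN (α) the map s̃ ↦ G̃′(s̃) on ζ̃Z(M̂)^{Γ,θ̂}/Z(Ĝ)^{Γ,θ̂} ∖ {ζ̃}
and s ↦ G′(s) on Z(M̂_U)^Γ/Z(Û(N))^Γ ∖ {1} index the SAME endoscopic groups U(N₁) × U(N₂) ⊃ M with (β) equal coefficients i (l.984 vs l.736)
and i₀ = 1 », « (α)/(β) are decidable statements about the finite groups Z(·)^Γ of the data U(N₁) × U(N₂) ⊂ G̃_{E/F}(N) / U(N) — typable as a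
kernel computation if the typer line wants the edge ».  This module performs that computation.  OUTCOME (details in §§3–5 and GAPS §TY-52):
(α) is FALSE as literally posed on [II]'s fine index set `ζ̃Z(M̂)^{Γ_F,θ̂}/Z(Ĝ)^{Γ_F,θ̂}` and TRUE on equivalence classes of data: every
elliptic pair (G′ ⊃ M′) of the untwisted side occurs on the twisted side exactly `2^r` times (`r` = number of GL-block pairs of the Levi),
`2^r = |det(1-θ^{M̃}; 𝒜_M/(𝒜_{M̃}+𝒜_G))|` being the kernel order of [I] 3.3 (2) — in particular `2^r - 1` fine indices `s̃ ≠ ζ̃` give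
`G′(s̃) = U(N)` again; (β) is TRUE class by class (coefficient `1` at `G′ = U(N)`, `1/2` at a proper product, on both sides; `i₀ = 1`).
Consequently (§5) the principal slice of [II] Thm 4.4 at this datum is EQUIVALENT to the single identity
`r^{G̃}_{M̃}(transfert(δ′), K̃) = 2^r · r^{U(N)}_{M′}(δ′, K)` in [II]'s measures, under the hypothesis `PairInvariance` (the stable terms
`s^{G′}_{M′}(δ′, ·)` depend only on the pair (G′ ⊃ M′) and the conjugacy class of the hyperspecial subgroup — which [II] 4.2 (1) and 4.3 print,
modulo this module's identification of pairs by “type”, (D125)); and it is equivalent to [Kt_1] §3's `WO_{δθ}(f_E) = WO_γ(f)` under the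
further hypothesis `Normalisation` (ONE non-zero constant relating [II]'s quadratic-form measures on `𝒜^{G̃}_{M̃} ≃ 𝒜^{G′}_{M′}` ([II] 1.2,
1.12, 4.3) to Kottwitz's weight `v_M` — [Kt_1] p. 248 « up to a scalar which will be 1 in a suitable normalization » — absorbing the `2^r`).
`Normalisation` is NOT adjudicated by the cell: it is the precise residue of Q-UP-61-a (GAPS G-TY-52-3).  Nothing here changes a status word
of the census (v22); row L09's `TWFL.needed`/`TWFL.supplied` (M56) are untouched.

THE MODEL (schematic but typed; every simplification is a DIVERGENCE2 §TY-52 row, labels (D121)–(D132) below).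
* `Ĝ = GL_N(ℂ) × GL_N(ℂ)` with [Mok] (2.1.2) « \widehat{\theta}((g,h)) &=& (\alpha(h),\alpha(g)) »; an endoscopic datum has `s̃ = (a,b)θ̂` and
  [Mok] l.753 « equivalently $\widehat{G}^{\prime}$ is the connected $\widehat{\theta}$-twisted centralizer of $s^0$ in $\widehat{G}^0$: »
  « &= &  \{ g \in \widehat{G}^0, \,\ g s^0 = s^0 \widehat{\theta}(g)       \}. » ([I] 1.5: « On suppose que ${\cal G}'\cap \hat{G}=\hat{G}_{\tilde{s}}$
  (composante neutre du commutant de $\tilde{s}$). »).  §1 proves, for ANY group `G` and ANY involutive automorphism `α` (no commutativity),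
  that this twisted centraliser `{(g,h) | g a = a α(h), h b = b α(g)}` is a subgroup of `G × G` isomorphic to the centraliser of the “norm”
  `y := a·α(b)` in `G` by `(g,h) ↦ g` (`twistedCentralizerEquiv`).  So `Ĝ′(s̃) ≅ Z_{GL_N}(y)` (connected, a Levi) — (D121).
* Centres only, as block scalars (§2): `M̂ = L × L`, `L ⊂ GL_N` the standard Levi of PALINDROMIC type `(n₁,…,n_r,n₀,n_r,…,n₁)` with `k` blocks
  (`k = 2r+1` if `n₀ > 0`, `k = 2r` if `n₀ = 0`), forced by `Γ_F`-stability ([II] 1.10 « on peut supposer  que $\hat{M}$ est un Levi standard et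
  que le $L$-espace $^L\tilde{M}$ est \'egal \`a $(\hat{M}\ltimes W_{F})\hat{\theta}$. »).  `Z(L) = (ℂ^×)^k` is `Fin k → C` over an abstract
  commutative group `C`; `α` restricted to `Z(L)` is `alphaZ z i = (z i.rev)⁻¹` (conjugation by the antidiagonal `Φ_N` reverses the blocks;
  its signs cancel on block scalars), `σ_G` = swap of the two factors (`sigmaZ`), `θ̂ = thetaZ` — (D122).  Proved: `Z(M̂)^{Γ,θ̂}` = pairs
  `(z,z)` with `z` ANTI-PALINDROMIC (`alphaZ_eq_self_iff`: `z i * z i.rev = 1`), `Z(Ĝ)^{Γ,θ̂} = {±1}` (`alphaZ_const_eq_self_iff`); the norm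
  of `s̃ = (z,z)·ζ̃` is `y = (z * alphaZ z) * y_ζ = z² · y_ζ` with the middle coordinate dropping out (`normY_translate_of_fixed`,
  `sq_apply_eq_one_of_rev_eq`); `Z(M̂)^Γ`-conjugation `s̃ ↦ λ s̃ λ⁻¹` fixes `y` (`normY_conj`, [I] 3.3 « Alors la donn\'ee ${\bf G}'(\tilde{s}')$
  est \'equivalente \`a ${\bf G}'(\tilde{s})$ »); `Z(Ĝ)`-translation rescales `y` (`normY_centre_translate`).
* PRINCIPAL datum of `M̃` ⟺ `M̂′ = (M̂ ∩ Ĝ′(ζ̃))⁰ = L` ([I] 3.3 « d'apr\`es les d\'efinitions, $\hat{M}'$ est \'egal \`a $(\hat{M}\cap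
  \hat{G}'(\tilde{s}))^0$. ») ⟺ `y_ζ ∈ Z(L)`; [I] 3.2 (1) « dans l'ensemble $Z(\hat{M})\tilde{\zeta}$, il existe une unique classe modulo
  $Z(\hat{M})^{\Gamma_{F}}Z(\hat{G})$ telle que, pour $\tilde{\zeta}'$ dans cette classe, $a_{M,\tilde{\zeta}'}$ prenne ses valeurs dans
  $Z(\hat{G})$. » forces `α(y_ζ) = c·y_ζ`, i.e. `y_ζ i * y_ζ i.rev` constant (`alphaZ_eq_const_mul_iff`), and the allowed renormalisation brings
  `y_ζ = 1`; the model takes `y_ζ = 1` — (D123).  Then `G′(s̃)` is ELLIPTIC ⟺ every eigenvalue `λ` of `y = z²` has `λ = λ⁻¹` (else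
  `Z(Ĝ′)^Γ ⊃` a torus `(c_λ, c_{λ⁻¹} = c_λ⁻¹)`) ⟺ `z_i⁴ = 1` (`normY_sq_isPMOne_iff`) — (D124); `Ĝ′ = GL_{N₁} × GL_{N₂}` = the (+1)- and (−1)-eigenspaces,
  `G′(s̃) = U(n₀+2n_A) × U(2n_B)`, `A = {i ≤ r | z_i = ±1}`, `B = {i ≤ r | z_i = ±√-1}`, with `M′` embedded blockwise: the “type” `B : Fin r →
  Bool` — (D125); [Mok] l.790 ff. « The equivalence class of the endoscopic datum $(G^{\prime},\xi^{\prime})$ is uniquely determined by the pair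
  $(N_1,N_2)$ and $\underline{\kappa}$ »; the signs `κ` are NOT modelled (D125).
* The kernel of [I] 3.3 (2) in the model: `z ↦` its class modulo `Z(Ĝ)^Γ·(1-θ̂)(Z(M̂)^Γ)` = constants · `{u * (alphaZ u)⁻¹}`; proved both ways
  WITHOUT square roots: an anti-palindromic `z` lies in that subgroup iff `z_i² = 1` for all `i` (`sq_eq_one_of_mem_image_oneSubTheta`,
  `mem_image_oneSubTheta_of_sq_eq_one`), so the kernel is `{±1-valued anti-palindromic z, ε}/±1`, of order `2^r` (`n₀ > 0`) — [I] 3.3 (2) « son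
  noyau a pour nombre d'\'el\'ements $\vert det((1-\theta^{\tilde{M}})_{\vert {\cal A}_{M}/({\cal A}_{\tilde{M}}+{\cal A}_{G}})\vert $. », whose
  proof counts, per orbit of `⟨Γ_F, θ̂⟩` on `Δ - Δ^M`, « $n$ le plus petit entier $\geq1$ tel que $\hat{\theta}^{n}(\alpha)\in[\alpha]$ »: here the
  orbits are the pairs `{j, N-j}` of block boundaries, `n = 2` each (`n = 1` for the middle boundary when `n₀ = 0`), `det = 2^r` (resp.
  `2^{r-1}`): `mw_kernel_exponent_odd/even`, `card_kernelCover` — (D130), with the abstract involution lemma of §4.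
* §3, the COUNT (`n₀ > 0`): fine elliptic indices = `FineIdxTw r := (t, (s, ε))`, `z_i = (√-1)^{t_i}·(-1)^{s_i}`, `ε` the middle sign, the
  quotient by `Z(Ĝ)^{Γ,θ̂} = ±1` implemented as the factor `1/2` over this double cover (`negTw` is free and type-preserving) — (D126); the
  coefficient ([II] 1.12 « $$i_{\tilde{M}'}(\tilde{G},\tilde{G}'(\tilde{s}))=[Z(\hat{M}')^{\Gamma_F}:(Z(\hat{M}')^{\Gamma_F}\cap
  Z(\hat{M}))][Z(\hat{G}'(\tilde{s}))^{\Gamma_F}:(Z(\hat{G}'(\tilde{s}))^{\Gamma_F}\cap Z(\hat{G}))]^{-1}.$$ »; here `Z(M̂′) = {(c, α c)} ⊂ Z(M̂)`,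
  first index `1`; `Z(Ĝ′)^Γ ∩ Z(Ĝ) = {±1}` inside `Z(Ĝ′)^Γ = {±1}^{#eigenvalues}`) is `coef t = 1` if `t ≡ false` (`G′ = U(N)`), `1/2` otherwise
  — (D128); untwisted side ([II] 1.10 « $$i_{\tilde{M}}(\tilde{G},\tilde{G}'(s))=\left\lbrace\begin{array}{cc}[Z(\hat{G}'(s))^{\Gamma_{F}}:Z(\hat{G})^{\Gamma_{F}}]^{-1},&
  \text{ si }{\bf G}'(s)\text{ est elliptique,}\\ 0,& \text{ sinon.}\\ \end{array}\right.$$ »): elliptic fine indices `FineIdxUn r := (z ∈ {±1}^r, ε)` (inside `Z(M̂_U)^{Γ_F} ≅ (ℂ^×)^r × {±1}`), classes ↔ `typeUn (z,ε) i := (z i ≠ ε)` (the blocks outside the `U(n₀+…)` factor), each type ONCE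
  modulo `±1`, same `coef` — (D127).  PROVED: `endoTw_eq : endoTw r t = 2^r * coef r t`, `endoUn_eq : endoUn r t = coef r t`, hence
  `endoTw_eq_two_pow_mul_endoUn` — the precise form of (α)/(β); the `n₀ = 0` variant on unordered types `{t, ¬t}` (`endoTw₀_class…`) — (D132);
  worked instances `r = 1` ([Mok] l.817 « for example for the Siegel Levi $M \cong G_{E/F}(N/2)$, the two Levi sub-data $(M,\xi_{\chi_+})$ and
  $(M,\xi_{\chi_-})$ are equivalent as twisted endoscopic datum of $\widetilde{G}_{E/F}(N)$ »: in the model, `r = 1`, `n₀ = 0`, both fine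
  elliptic classes have `G′ = U(N)`).
* §5, the STATEMENTS: a `SliceData r` packages the complex numbers of the slice (D129) — `sTw t` = [II] 4.3's `s^{G′(s̃)}_{M′}(δ′, K̃)` for the
  type `t`, `sUn t` = [II] 4.2's `s^{G′(s)}_{M′}(δ′, K)` (with `sUn (fun _ ↦ false) = s^{U(N)}_{M′}`), `rTw = r^{G̃}_{M̃}(transfert(δ′), K̃)`,
  `rUn = r^{U(N)}_{M′}(δ′, K)` ([II] 4.1
  « $$r_{\tilde{M}}^{\tilde{G}}(\boldsymbol{\gamma},\tilde{K})=J_{\tilde{M}}^{\tilde{G}}(\boldsymbol{\gamma},{\bf 1}_{\tilde{K}})$$ »), `ktTw`/`ktUn` = the two sides of [Kt_1] §3.  `MW44PrincipalSlice W` := [II] 4.3 (1) = 4.4's right side with the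
  model's multiplicities; `MW42Def4 W` := [II] 4.2 (4) solved for `r`; `PairInvariance`, `Kt1Sec3`, `Normalisation` as said.  PROVED:
  `mw44PrincipalSlice_iff : MW42Def4 W → PairInvariance W → (MW44PrincipalSlice W ↔ W.rTw = 2^r * W.rUn)` and
  `mw44PrincipalSlice_iff_kt1 : … → Normalisation W → (MW44PrincipalSlice W ↔ Kt1Sec3 W)`.
What is NOT modelled: reductive groups, L-groups, Galois cohomology, measures, orbital integrals, transfer factors, the `κ`-signs ([Mok]
l.800 « (1,-1) \mbox{ or } (-1,1) \mbox{ if } N_1 \equiv N_2 \bmod{2} »), the real vector space `𝒜_M` (only its dimension count), the print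
editions.  0 `sorry`, 0 `axiom`, 0 `opaque`, no named unproved fact; `set_option autoImplicit false`.
-/

set_option autoImplicit false

namespace Literature.NumberTheory.Automorphic.Arthur2013.Leaves.TwistedPrincipalSlice

/-! ## §1 The `θ̂`-twisted centraliser in `Ĝ × Ĝ` is the centraliser of the norm `a·α(b)` in `Ĝ` -/

section TwistedCentralizer

variable {G : Type*} [Group G]

/-- §1 (1). The `θ̂`-TWISTED CENTRALISER of `s̃ = (a,b)·θ̂` in `G × G`, for `θ̂(g,h) = (α h, α g)`:
the pairs `(g,h)` with `(g,h)·(a,b) = (a,b)·θ̂(g,h)`, i.e. `g a = a α(h)` and `h b = b α(g)` — a subgroup, for ANY group `G` and ANY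
`α : G ≃* G` (involutivity is needed only from (3) on).  [Mok] (2.1.2), main.tex l.303 « Finally we denote by $\widehat{\theta}$ the following
automorphism of $\widehat{G}_{E/F}(N)$: » « \widehat{\theta}((g,h)) &=& (\alpha(h),\alpha(g)) »; l.751–758 « with $s$ considered up to
translation by $Z(\widehat{G}^0)^{\Gamma_F}$ » … « equivalently $\widehat{G}^{\prime}$ is the connected $\widehat{\theta}$-twisted centralizer
of $s^0$ in $\widehat{G}^0$: » « &= &  \{ g \in \widehat{G}^0, \,\ g s^0 = s^0 \widehat{\theta}(g)       \}. »  Model divergence (D121): `G` is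
abstract (for [Mok], `G = GL_N(ℂ)` and `α(g) = Φ_N ᵗg⁻¹ Φ_N⁻¹`); connected components are not modelled.
[cite: Mok2012, (2.1.2) l.303-308, §2.1 l.748-758; Waldspurger2014StabilisationI, 1.5 l.151-152] -/
def twistedCentralizer (α : G ≃* G) (a b : G) : Subgroup (G × G) where
  carrier := {p | p.1 * a = a * α p.2 ∧ p.2 * b = b * α p.1}
  one_mem' := by simp
  mul_mem' := by
    rintro ⟨g₁, h₁⟩ ⟨g₂, h₂⟩ ⟨hg₁, hh₁⟩ ⟨hg₂, hh₂⟩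
    simp only [Prod.fst_mul, Prod.snd_mul, map_mul, Set.mem_setOf_eq] at *
    refine ⟨?_, ?_⟩
    · calc g₁ * g₂ * a = g₁ * (g₂ * a) := by rw [mul_assoc]
        _ = g₁ * (a * α h₂) := by rw [hg₂]
        _ = (g₁ * a) * α h₂ := by rw [mul_assoc]
        _ = a * α h₁ * α h₂ := by rw [hg₁]
        _ = a * (α h₁ * α h₂) := by rw [mul_assoc]
    · calc h₁ * h₂ * b = h₁ * (h₂ * b) := by rw [mul_assoc]
        _ = h₁ * (b * α g₂) := by rw [hh₂]
        _ = (h₁ * b) * α g₂ := by rw [mul_assoc]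
        _ = b * α g₁ * α g₂ := by rw [hh₁]
        _ = b * (α g₁ * α g₂) := by rw [mul_assoc]
  inv_mem' := by
    rintro ⟨g, h⟩ ⟨hg, hh⟩
    simp only [Prod.inv_mk, map_inv, Set.mem_setOf_eq] at *
    refine ⟨?_, ?_⟩
    · rw [inv_mul_eq_iff_eq_mul, ← mul_assoc, hg, mul_assoc, mul_inv_cancel, mul_one]
    · rw [inv_mul_eq_iff_eq_mul, ← mul_assoc, hh, mul_assoc, mul_inv_cancel, mul_one]

/-- §1 (1a). Membership in the twisted centraliser, definitionally. [folklore] (proved here; helper) [cite: Mok2012, §2.1 l.753-758] -/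
@[simp] theorem mem_twistedCentralizer_iff {α : G ≃* G} {a b : G} {p : G × G} :
    p ∈ twistedCentralizer α a b ↔ (p.1 * a = a * α p.2 ∧ p.2 * b = b * α p.1) :=
  Iff.rfl

/-- §1 (2). If `(g,h)` lies in the twisted centraliser of `(a,b)θ̂` and `α` is involutive, then `g` commutes with the
NORM `y := a·α(b)`: `g·y = g a α(b) = a α(h) α(b) = a α(h b) = a α(b α(g)) = a α(b) g = y·g`.  No commutativity of `G` is used.
[folklore] (proved here; the norm map of base change, cf. [Kt_1] §3 « N8 » [OCR sic, = Nδ]) [cite: Mok2012, §2.1 l.753-758; Kottwitz1986BaseChangeUnits, §3 p. 248] -/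
theorem fst_mul_norm_comm {α : G ≃* G} (hα : ∀ g, α (α g) = g) {a b : G} {p : G × G}
    (hp : p ∈ twistedCentralizer α a b) : p.1 * (a * α b) = (a * α b) * p.1 := by
  obtain ⟨h1, h2⟩ := hp
  calc p.1 * (a * α b) = (p.1 * a) * α b := by rw [mul_assoc]
    _ = a * α p.2 * α b := by rw [h1]
    _ = a * α (p.2 * b) := by rw [mul_assoc, map_mul]
    _ = a * α (b * α p.1) := by rw [h2]
    _ = a * (α b * p.1) := by rw [map_mul, hα]
    _ = a * α b * p.1 := by rw [mul_assoc]

/-- §1 (2a). In the twisted centraliser the second coordinate is determined by the first: `h = α(a⁻¹ g a)` (apply `α` to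
`g a = a α(h)` and use `α ∘ α = id`). [folklore] (proved here; helper) [cite: Mok2012, §2.1 l.753-758] -/
theorem snd_eq_of_mem {α : G ≃* G} (hα : ∀ g, α (α g) = g) {a b : G} {p : G × G}
    (hp : p ∈ twistedCentralizer α a b) : p.2 = α (a⁻¹ * p.1 * a) := by
  obtain ⟨h1, _⟩ := hp
  have h : a⁻¹ * p.1 * a = α p.2 := by
    rw [mul_assoc, h1, ← mul_assoc, inv_mul_cancel, one_mul]
  rw [h, hα]

/-- §1 (2b). Conversely every `g` commuting with the norm `a·α(b)` lifts to the twisted centraliser as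
`(g, α(a⁻¹ g a))`: the second defining relation `α(a⁻¹ g a)·b = b·α(g)` is `α` applied to `g·y = y·g`. [folklore] (proved here; helper)
[cite: Mok2012, §2.1 l.753-758] -/
theorem mk_mem_of_mul_norm_comm {α : G ≃* G} (hα : ∀ g, α (α g) = g) {a b g : G}
    (hg : g * (a * α b) = (a * α b) * g) :
    (g, α (a⁻¹ * g * a)) ∈ twistedCentralizer α a b := by
  refine ⟨?_, ?_⟩
  · show g * a = a * α (α (a⁻¹ * g * a))
    rw [hα, ← mul_assoc, ← mul_assoc, mul_inv_cancel, one_mul]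
  · show α (a⁻¹ * g * a) * b = b * α g
    have h' : α g * (α a * b) = (α a * b) * α g := by
      have h0 := congrArg α hg
      simpa only [map_mul, hα] using h0
    rw [map_mul, map_mul, map_inv]
    calc (α a)⁻¹ * α g * α a * b = (α a)⁻¹ * (α g * (α a * b)) := by simp only [mul_assoc]
      _ = (α a)⁻¹ * ((α a * b) * α g) := by rw [h']
      _ = b * α g := by rw [← mul_assoc, ← mul_assoc, inv_mul_cancel, one_mul]

/-- §1 (3). THE DICTIONARY `Ĝ′(s̃) ≅ Z_{Ĝ⁰-factor}(norm)`: for an involutive `α`, projection to the first factor is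
a group ISOMORPHISM from the `θ̂`-twisted centraliser of `(a,b)θ̂` in `G × G` onto the centraliser of `a·α(b)` in `G`, with inverse
`g ↦ (g, α(a⁻¹ g a))`.  For [Mok]'s `Ĝ_{E/F}(N) = GL_N(ℂ) × GL_N(ℂ)` this identifies the dual group of the datum attached to `s̃ = (a,b)θ̂`
([I] 1.5, l.151 « Le terme $\tilde{s}$ est un \'el\'ement semi-simple de $\hat{G}\hat{\boldsymbol{\theta}}$. » « On suppose que ${\cal G}'\cap
\hat{G}=\hat{G}_{\tilde{s}}$ (composante neutre du commutant de $\tilde{s}$). ») with `Z_{GL_N(ℂ)}(a·α(b))`, a Levi subgroup of `GL_N(ℂ)`, hence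
connected (D121).  [folklore] (proved here) [cite: Mok2012, (2.1.2) l.303-308, §2.1 l.748-758; Waldspurger2014StabilisationI, 1.5 l.151-152, 3.3 l.1143] -/
def twistedCentralizerEquiv (α : G ≃* G) (hα : ∀ g, α (α g) = g) (a b : G) :
    twistedCentralizer α a b ≃* Subgroup.centralizer ({a * α b} : Set G) where
  toFun p := ⟨p.1.1, by
    rw [Subgroup.mem_centralizer_iff]
    intro m hm
    rw [Set.mem_singleton_iff] at hm
    subst hm
    exact (fst_mul_norm_comm hα p.2).symm⟩
  invFun g := ⟨(g.1, α (a⁻¹ * g.1 * a)), mk_mem_of_mul_norm_comm hα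
    ((Subgroup.mem_centralizer_iff.mp g.2) (a * α b) (Set.mem_singleton _)).symm⟩
  left_inv p := by
    apply Subtype.ext
    apply Prod.ext
    · rfl
    · exact (snd_eq_of_mem hα p.2).symm
  right_inv g := Subtype.ext rfl
  map_mul' p q := Subtype.ext rfl

/-- §1 (3a). The isomorphism (3) is the first projection on underlying elements. [folklore] (proved here; helper) [cite: Mok2012, §2.1 l.753-758] -/
theorem twistedCentralizerEquiv_apply (α : G ≃* G) (hα : ∀ g, α (α g) = g) (a b : G)
    (p : twistedCentralizer α a b) : ((twistedCentralizerEquiv α hα a b p : Subgroup.centralizer ({a * α b} : Set G)) : G) = p.1.1 :=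
  rfl

/-- §1 (3b). Two elements of the twisted centraliser with the same first coordinate are equal (involutive `α`).
[folklore] (proved here; helper) [cite: Mok2012, §2.1 l.753-758] -/
theorem fst_injective_on_twistedCentralizer {α : G ≃* G} (hα : ∀ g, α (α g) = g) {a b : G}
    {p q : G × G} (hp : p ∈ twistedCentralizer α a b) (hq : q ∈ twistedCentralizer α a b)
    (h : p.1 = q.1) : p = q := by
  apply Prod.ext h
  rw [snd_eq_of_mem hα hp, snd_eq_of_mem hα hq, h]

end TwistedCentralizer

/-! ## §2 The block-scalar model of the centres -/

section BlockModel

variable {k : ℕ} {C : Type*} [CommGroup C]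

/-- §2 (4). BLOCK-SCALAR MODEL of the centre `Z(L) = (ℂ^×)^k` of the standard Levi `L ⊂ GL_N(ℂ)` with `k` blocks of PALINDROMIC sizes
`(n₁,…,n_r,n₀,n_r,…,n₁)` (so that `L × L` is `Γ_F`- and `θ̂`-stable: [II] 1.10, l.736 « on peut supposer  que $\hat{M}$ est un Levi standard et
que le $L$-espace $^L\tilde{M}$ est \'egal \`a $(\hat{M}\ltimes W_{F})\hat{\theta}$. »): an element is `z : Fin k → C` over an abstract
commutative group `C` (for [Mok], `C = ℂ^×`), and `α(g) = Φ_N ᵗg⁻¹ Φ_N⁻¹` ([Mok] (2.1.2)) restricted to block scalars is `z ↦ (i ↦ (z (rev i))⁻¹)`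
— conjugation by the antidiagonal `Φ_N` reverses the order of the blocks and its signs cancel on scalars.  Divergence (D122).
[cite: Mok2012, (2.1.2) l.303-308; Waldspurger2014StabilisationII, 1.10 l.736] -/
def alphaZ (z : Fin k → C) : Fin k → C := fun i => (z i.rev)⁻¹

/-- §2 (4a). `alphaZ z i = (z i.rev)⁻¹`, definitionally. [folklore] (proved here; helper) [cite: Mok2012, (2.1.2) l.303-308] -/
@[simp] theorem alphaZ_apply (z : Fin k → C) (i : Fin k) : alphaZ z i = (z i.rev)⁻¹ := rfl

/-- §2 (4b). `α` is an involution on block scalars. [folklore] (proved here; helper) [cite: Mok2012, (2.1.2) l.303-308] -/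
theorem alphaZ_alphaZ (z : Fin k → C) : alphaZ (alphaZ z) = z := by
  funext i; simp [Fin.rev_rev]

/-- §2 (4c). `α` is multiplicative on block scalars. [folklore] (proved here; helper) [cite: Mok2012, (2.1.2) l.303-308] -/
theorem alphaZ_mul (z w : Fin k → C) : alphaZ (z * w) = alphaZ z * alphaZ w := by
  funext i; simp [mul_comm]

/-- §2 (4d). `α` commutes with inversion on block scalars. [folklore] (proved here; helper) [cite: Mok2012, (2.1.2) l.303-308] -/
theorem alphaZ_inv (z : Fin k → C) : alphaZ z⁻¹ = (alphaZ z)⁻¹ := by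
  funext i; simp

/-- §2 (5). `α`-FIXED block scalars are the ANTI-PALINDROMIC ones: `α z = z ↔ ∀ i, z i * z i.rev = 1`.  With (6) this
describes `Z(M̂)^{Γ_F,θ̂}` of [II] 1.12 / 4.3 (l.979 « Soit $\tilde{s}\in \tilde{\zeta}Z(\hat{M})^{\Gamma_{F},\hat{\theta}}$. On construit la
donn\'ee endoscopique ${\bf G}'(\tilde{s})=(G'(\tilde{s}),{\cal G}'(\tilde{s}),\tilde{s})$, cf. [I] 3.3. ») in the model: pairs `(z,z)`, `z`
anti-palindromic; for `k = 2r+1` the middle coordinate is `±1` (the sign `ε` of §3), the first `r` coordinates are free.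
[folklore] (proved here) [cite: Waldspurger2014StabilisationII, 1.12 l.979, 4.3 l.2425-2430; Mok2012, (2.1.2) l.303-308] -/
theorem alphaZ_eq_self_iff (z : Fin k → C) : alphaZ z = z ↔ ∀ i, z i * z i.rev = 1 := by
  constructor
  · intro h i
    have hi := congrFun h i.rev
    simp only [alphaZ_apply, Fin.rev_rev] at hi
    rw [← hi, mul_inv_cancel]
  · intro h
    funext i
    simp only [alphaZ_apply]
    exact (eq_inv_of_mul_eq_one_left (h i)).symm

/-- §2 (5a). On the centre `Z(Ĝ⁰-factor) = ` constants, `α` is inversion. [folklore] (proved here; helper) [cite: Mok2012, (2.1.2) l.303-308] -/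
theorem alphaZ_const (c : C) : alphaZ (fun _ : Fin k => c) = fun _ => c⁻¹ := rfl

/-- §2 (5b). `Z(Ĝ)^{Γ_F,θ̂}` in the model (`k > 0`): a constant pair `(c,c)` is `θ̂`-fixed iff `c * c = 1`, i.e.
`Z(Ĝ)^{Γ_F,θ̂} = {±1}` for `C = ℂ^×` — the group by which [II] 4.3 (1) quotients its index set
« $\tilde{s}\in \tilde{\zeta}Z(\hat{M})^{\Gamma_{F},\hat{\theta}}/Z(\hat{G})^{\Gamma_{F},\hat{\theta}}$ » (l.2425), and [Mok] l.751 « with $s$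
considered up to translation by $Z(\widehat{G}^0)^{\Gamma_F}$ ».  [folklore] (proved here)
[cite: Waldspurger2014StabilisationII, 4.3 l.2425; Mok2012, §2.1 l.751] -/
theorem alphaZ_const_eq_self_iff (hk : 0 < k) (c : C) :
    alphaZ (fun _ : Fin k => c) = (fun _ => c) ↔ c * c = 1 := by
  rw [alphaZ_eq_self_iff]
  constructor
  · intro h; exact h ⟨0, hk⟩
  · intro h _; exact h

/-- §2 (6). `θ̂` on `Z(M̂) = Z(L) × Z(L)`: `(z,w) ↦ (α w, α z)` ([Mok] (2.1.2) « \widehat{\theta}((g,h)) &=& (\alpha(h),\alpha(g)) »).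
(D122) [cite: Mok2012, (2.1.2) l.303-308] -/
def thetaZ (p : (Fin k → C) × (Fin k → C)) : (Fin k → C) × (Fin k → C) := (alphaZ p.2, alphaZ p.1)

/-- §2 (6a). The Galois action of `w_c ∈ W_F ∖ W_E` on `Ĝ_{E/F}(N) = GL_N(ℂ) × GL_N(ℂ)` restricted to `Z(M̂)`: the swap
`(z,w) ↦ (w,z)` ([Mok] l.297 « then $w_c$ acts on $\GL_N(\mathbf{C}) \times \GL_N(\mathbf{C})$ as the automorphsim $\beta$ that interchanges
the two factors » [sic] « \beta((g,h)) =(h,g) \mbox{ for } (g,h) \in \GL_N(\mathbf{C}) \times \GL_N(\mathbf{C}). »).  (D122)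
[cite: Mok2012, §2.1 l.290-300] -/
def sigmaZ (p : (Fin k → C) × (Fin k → C)) : (Fin k → C) × (Fin k → C) := (p.2, p.1)

/-- §2 (6b). `Z(M̂)^{Γ_F,θ̂}` in the model: a pair is fixed by `σ` (swap) and `θ̂` iff it is `(z,z)` with `α z = z` (then use (5)).
[folklore] (proved here) [cite: Waldspurger2014StabilisationII, 1.12 l.979, 4.3 l.2425; Mok2012, (2.1.2) l.303-308] -/
theorem fixed_iff (p : (Fin k → C) × (Fin k → C)) :
    (sigmaZ p = p ∧ thetaZ p = p) ↔ (p.2 = p.1 ∧ alphaZ p.1 = p.1) := by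
  obtain ⟨z, w⟩ := p
  simp only [sigmaZ, thetaZ, Prod.mk.injEq]
  constructor
  · rintro ⟨⟨h1, _⟩, _, h3⟩
    subst h1
    exact ⟨rfl, h3⟩
  · rintro ⟨h1, h2⟩
    subst h1
    exact ⟨⟨rfl, rfl⟩, h2, h2⟩

/-- §2 (7). The NORM of `s̃ = (a,b)θ̂` on block scalars: `y = a * α b` — by §1 (3) the centraliser of `y` is `Ĝ′(s̃)`; for
`a, b ∈ Z(L)` (the case of every `s̃ ∈ Z(M̂)ζ̃` once `y_ζ ∈ Z(L)`, (8)) `y ∈ Z(L)` and `Z_{GL_N}(y)` is the standard Levi whose blocks are the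
unions of `L`-blocks on which `y` is constant.  [folklore] (definition of the model, (D121)/(D122))
[cite: Mok2012, §2.1 l.753-758; Waldspurger2014StabilisationI, 3.3 l.1143] -/
def normY (a b : Fin k → C) : Fin k → C := a * alphaZ b

/-- §2 (7a). `normY a b i = a i * (b i.rev)⁻¹`, definitionally. [folklore] (proved here; helper) [cite: Mok2012, §2.1 l.753-758] -/
@[simp] theorem normY_apply (a b : Fin k → C) (i : Fin k) : normY a b i = a i * (b i.rev)⁻¹ := rfl

/-- §2 (7b). TRANSLATION LAW: replacing `s̃ = (a,b)θ̂` by `(z,z)·s̃` multiplies the norm by `z * α z`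
(`= (z_i · z_{rev i}⁻¹)_i`).  [folklore] (proved here) [cite: Waldspurger2014StabilisationII, 4.3 l.2425-2430; Mok2012, §2.1 l.753-758] -/
theorem normY_translate (z a b : Fin k → C) :
    normY (z * a) (z * b) = (z * alphaZ z) * normY a b := by
  funext i
  simp only [normY_apply, Pi.mul_apply, alphaZ_apply, mul_inv]
  simp only [mul_assoc, mul_left_comm]

/-- §2 (7c). For `(z,z) ∈ Z(M̂)^{Γ_F,θ̂}` (i.e. `α z = z`, (5)/(6b)) the norm is multiplied by `z * z = z²`: the
index `s̃ = (z,z)ζ̃` of [II] 4.3 (1) has norm `z² · y_ζ`; by (7d) the middle coordinate (`k` odd) does not move the norm at all — the first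
source of MULTIPLICITY in the fine index set (the sign `ε` of §3).  [folklore] (proved here)
[cite: Waldspurger2014StabilisationII, 4.3 l.2425-2430; Waldspurger2014StabilisationI, 3.3 l.1158-1163] -/
theorem normY_translate_of_fixed (z a b : Fin k → C) (hz : alphaZ z = z) :
    normY (z * a) (z * b) = (z * z) * normY a b := by
  rw [normY_translate, hz]

/-- §2 (7d). For anti-palindromic `z` and a self-reversed index `i` (the middle block, `k` odd): `(z*z) i = 1`.
[folklore] (proved here; helper) [cite: Waldspurger2014StabilisationI, 3.3 l.1158-1163] -/
theorem sq_apply_eq_one_of_rev_eq (z : Fin k → C) (hz : alphaZ z = z) (i : Fin k) (hi : i.rev = i) :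
    (z * z) i = 1 := by
  have h := (alphaZ_eq_self_iff z).mp hz i
  rw [hi] at h
  exact h

/-- §2 (7e). `Z(M̂)^{Γ_F}`-CONJUGATION does not move the norm.  In the model `Z(M̂)^{Γ_F}` (pairs fixed by the swap) is
`{(u,u)}`, and `λ s̃ λ⁻¹ = (u,u)·(a,b)θ̂·(u,u)⁻¹ = (u a (α u)⁻¹, u b (α u)⁻¹)θ̂`; its norm equals the norm of `(a,b)`.  This is the model's
shadow of [I] 3.3, l.1158 « Pour $\lambda\in Z(\hat{M} )^{\Gamma_{F}}$ et $\nu\in Z(\hat{G})^{\Gamma_{F}}$, posons $\tilde{s}'=\nu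
\lambda\tilde{s}\lambda^{-1}$. Alors la donn\'ee ${\bf G}'(\tilde{s}')$ est \'equivalente \`a ${\bf G}'(\tilde{s})$ »: conjugate indices give
the same `Ĝ′`.  [folklore] (proved here) [cite: Waldspurger2014StabilisationI, 3.3 l.1158] -/
theorem normY_conj (u a b : Fin k → C) :
    normY (u * a * (alphaZ u)⁻¹) (u * b * (alphaZ u)⁻¹) = normY a b := by
  funext i
  simp only [normY_apply, Pi.mul_apply, Pi.inv_apply, alphaZ_apply, Fin.rev_rev, inv_inv]
  calc u i * a i * u i.rev * (u i.rev * b i.rev * u i)⁻¹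
      = u i * a i * u i.rev * ((u i)⁻¹ * ((b i.rev)⁻¹ * (u i.rev)⁻¹)) := by
        rw [mul_inv_rev, mul_inv_rev, mul_assoc]
    _ = a i * (b i.rev)⁻¹ * (u i * (u i)⁻¹) * (u i.rev * (u i.rev)⁻¹) := by
        simp only [mul_assoc, mul_comm, mul_left_comm]
    _ = a i * (b i.rev)⁻¹ := by simp

/-- §2 (7f). `Z(Ĝ)`-TRANSLATION `(c, d)·s̃` (constants) rescales the norm by the constant `c d⁻¹`: the norm is an
invariant of the datum only up to scalars ([I] 3.3 l.1158, `ν ∈ Z(Ĝ)^{Γ_F}`; [Mok] l.751).  Used in (8) to normalise `y_ζ`.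
[folklore] (proved here) [cite: Waldspurger2014StabilisationI, 3.3 l.1158; Mok2012, §2.1 l.751] -/
theorem normY_centre_translate (c d : C) (a b : Fin k → C) :
    normY ((fun _ => c) * a) ((fun _ => d) * b) = (fun _ => c * d⁻¹) * normY a b := by
  funext i
  simp only [normY_apply, Pi.mul_apply, mul_inv]
  simp only [mul_assoc, mul_left_comm]

/-- §2 (8). THE PRINCIPAL DATUM's norm.  `𝐌′` principal (endoscopic group `M′ = M`, the Levi of `U(N)`,
with `M̂′ = L`) means, by [I] 3.3 l.1147 « d'apr\`es les d\'efinitions, $\hat{M}'$ est \'egal \`a $(\hat{M}\cap \hat{G}'(\tilde{s}))^0$. » at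
`s̃ = ζ̃ = (a,b)θ̂` and §1 (3), that `Z_L(y_ζ) = L`, i.e. `y_ζ ∈ Z(L)`.  The `σ`-component of `𝓜′` is `(x₁,x₂)σ` with `xᵢ ∈ L`, and
`(x₁,x₂)σ·(a,b)θ̂·((x₁,x₂)σ)⁻¹ = (x₁ b α(x₂)⁻¹, x₂ a α(x₁)⁻¹)θ̂` has norm `x₁ α(y_ζ) x₁⁻¹ = α(y_ζ)` (block scalars commute with `L`).  [I] 3.2
(1), l.1110 « (1) dans l'ensemble $Z(\hat{M})\tilde{\zeta}$, il existe une unique classe modulo $Z(\hat{M})^{\Gamma_{F}}Z(\hat{G})$ telle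
que, pour $\tilde{\zeta}'$ dans cette classe, $a_{M,\tilde{\zeta}'}$ prenne ses valeurs dans $Z(\hat{G})$. » (proof: « Pour $z\in
Z(\hat{M})$, on calcule $a_{M,z\tilde{\zeta}}(w)=zw(z)^{-1}a_{M,\tilde{\zeta}}(w)$. ») and [II] 1.12 l.979 « on impose que le cocycle $a_{M}$
associ\'e \`a cette donn\'ee prend ses valeurs dans $Z(\hat{G})$ » make that conjugate equal to `(c₁ a, c₂ b)θ̂` with `(c₁,c₂) ∈ Z(Ĝ)`
(scalars), of norm `c₁c₂⁻¹ · y_ζ`; hence `α(y_ζ) = c · y_ζ` for a constant `c`.  THIS LEMMA: `α y = c·y ↔ ∀ i, y i * y i.rev = c⁻¹` — the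
products over reversed blocks are CONSTANT.  Translating `ζ̃` inside its class by `(u,u) ∈ Z(M̂)^{Γ_F}` ((7b): factor `u_i u_{rev i}⁻¹`,
arbitrary on each pair) and by `Z(Ĝ)` ((7f): a constant factor) one reaches `y_ζ = 1`, which the model ADOPTS (D123; the residual middle
sign is moved by `(-1, 1) ∈ Z(Ĝ)` followed by a `Z(M̂)^{Γ_F}`-translation).  [folklore] (proved here)
[cite: Waldspurger2014StabilisationI, 3.2 l.1110-1112, 3.3 l.1143-1147; Waldspurger2014StabilisationII, 1.12 l.979] -/
theorem alphaZ_eq_const_mul_iff (y : Fin k → C) (c : C) :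
    alphaZ y = (fun _ => c) * y ↔ ∀ i, y i * y i.rev = c⁻¹ := by
  constructor
  · intro h i
    have hi := congrFun h i.rev
    simp only [alphaZ_apply, Fin.rev_rev, Pi.mul_apply] at hi
    -- hi : (y i)⁻¹ = c * y i.rev
    have : y i * (c * y i.rev) = 1 := by rw [← hi, mul_inv_cancel]
    calc y i * y i.rev = c⁻¹ * (c * (y i * y i.rev)) := by rw [← mul_assoc, inv_mul_cancel, one_mul]
      _ = c⁻¹ * (y i * (c * y i.rev)) := by simp only [mul_comm, mul_left_comm]
      _ = c⁻¹ := by rw [this, mul_one]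
  · intro h
    funext i
    simp only [alphaZ_apply, Pi.mul_apply]
    have hi := h i.rev
    rw [Fin.rev_rev] at hi
    -- hi : y i.rev * y i = c⁻¹
    rw [inv_eq_iff_eq_inv]
    have : y i.rev * (c * y i) = 1 := by
      calc y i.rev * (c * y i) = c * (y i.rev * y i) := by simp only [mul_comm, mul_left_comm]
        _ = 1 := by rw [hi, mul_inv_cancel]
    exact eq_inv_of_mul_eq_one_left this

/-- §2 (9). Palindromic block scalars `w (rev i) = w i` — the shape of `(1-θ̂)(Z(M̂)^{Γ_F})` in the model: for `(u,u) ∈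
Z(M̂)^{Γ_F}`, `(u,u)·θ̂(u,u)⁻¹ = (u (α u)⁻¹, u (α u)⁻¹)` and `(u * (α u)⁻¹) i = u i * u (rev i)` is palindromic (9a).  [I] 3.3 l.1158 « cet
ensemble de classes de conjugaison s'identifie \`a  $Z(\hat{M})^{\Gamma_{F}}/(Z(\hat{G})^{\Gamma_{F}}(1-\hat{\theta})(Z(\hat{M})^{\Gamma_{F}}))$. »
[folklore] (definition of the model) [cite: Waldspurger2014StabilisationI, 3.3 l.1158-1163] -/
def IsPalindromic (w : Fin k → C) : Prop := ∀ i, w i.rev = w i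

/-- §2 (9a). `u * (α u)⁻¹` is palindromic. [folklore] (proved here; helper) [cite: Waldspurger2014StabilisationI, 3.3 l.1158-1163] -/
theorem isPalindromic_mul_alphaZ_inv (u : Fin k → C) : IsPalindromic (u * (alphaZ u)⁻¹) := by
  intro i
  simp only [Pi.mul_apply, Pi.inv_apply, alphaZ_apply, inv_inv, Fin.rev_rev, mul_comm]

/-- §2 (9b). If an anti-palindromic `z` is a constant times a palindromic element then `z i * z i = 1` for all `i`
(`z_{rev i} = z_i⁻¹` and `z_{rev i} = z_i`).  [folklore] (proved here; helper for (10)) [cite: Waldspurger2014StabilisationI, 3.3 l.1160-1165] -/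
theorem sq_eq_one_of_mem_kernel (z : Fin k → C) (hz : alphaZ z = z)
    (hmem : ∃ (c : C) (w : Fin k → C), IsPalindromic w ∧ z = (fun _ => c) * w) :
    ∀ i, z i * z i = 1 := by
  obtain ⟨c, w, hw, rfl⟩ := hmem
  intro i
  have h := (alphaZ_eq_self_iff _).mp hz i
  simp only [Pi.mul_apply] at h ⊢
  rw [hw i] at h
  exact h

/-- §2 (9d). Weak converse of (9b): an anti-palindromic `±1`-valued `z` is itself palindromic (constant `1`
times a palindromic element).  Superseded by (10), kept as a helper. [folklore] (proved here; helper) [cite: Waldspurger2014StabilisationI, 3.3 l.1160-1165] -/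
theorem mem_kernel_of_sq_eq_one (z : Fin k → C) (hz : alphaZ z = z) (hsq : ∀ i, z i * z i = 1) :
    ∃ (c : C) (w : Fin k → C), IsPalindromic w ∧ z = (fun _ => c) * w := by
  refine ⟨1, z, ?_, ?_⟩
  · intro i
    have h := (alphaZ_eq_self_iff _).mp hz i
    -- z i * z i.rev = 1 and z i * z i = 1 ⇒ z i.rev = z i
    have h1 : z i.rev = (z i)⁻¹ := eq_inv_of_mul_eq_one_right h
    have h2 : z i = (z i)⁻¹ := eq_inv_of_mul_eq_one_right (hsq i)
    rw [h1, ← h2]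
  · funext i; simp

/-- §2 (9c). `Fin.rev` has at most one fixed point (the middle block). [folklore] (proved here; helper) [cite: Waldspurger2014StabilisationI, 3.3 l.1165] -/
theorem rev_eq_self_unique {i m : Fin k} (hi : i.rev = i) (hm : m.rev = m) : i = m := by
  apply Fin.ext
  have h1 := congrArg Fin.val hi
  have h2 := congrArg Fin.val hm
  rw [Fin.val_rev] at h1 h2
  omega

/-- §2 (10). THE KERNEL OF [I] 3.3 (2) IN THE MODEL, hard direction, WITHOUT SQUARE ROOTS: an
anti-palindromic `±1`-valued `z` (`z i * z i = 1`) is a constant `c` with `c * c = 1` times an element `u * (α u)⁻¹` of `(1-θ̂)(Z(M̂)^{Γ_F})`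
(take `c = z(middle)` if there is a middle block, else `c = 1`, and `u = z·c⁻¹` on the first half, `1` on the second).  With (10a) the
kernel of [I] 3.3 (2), l.1160 « (2) l'homomorphisme naturel » `Z(M̂)^{Γ_F,θ̂}/Z(Ĝ)^{Γ_F,θ̂} → Z(M̂)^{Γ_F}/(Z(Ĝ)^{Γ_F}(1-θ̂)(Z(M̂)^{Γ_F}))`
« est surjectif; son noyau a pour nombre d'\'el\'ements $\vert det((1-\theta^{\tilde{M}})_{\vert {\cal A}_{M}/({\cal A}_{\tilde{M}}+{\cal
A}_{G}})\vert $. » is, in the model, `{anti-palindromic z with z_i = ±1}/{±1}`: `2^r·2/2 = 2^r` elements for `k = 2r+1` (`r` free signs and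
`ε`), `2^r/2 = 2^{r-1}` for `k = 2r` — §3 (16).  MW's proof (l.1165) « Tout se d\'ecompose selon les orbites dans $\Delta- \Delta^M$ de
l'action du groupe engendr\'e par $\Gamma_{F}$ et $\hat{\theta}$ », « $n$ le plus petit entier $\geq1$ tel que $\hat{\theta}^{n}(\alpha)\in[\alpha]$ »,
« Il appartient \`a $(1-\hat{\theta})(Z(\hat{M}_{ad})^{\Gamma_{F}})$ si et seulement si $\prod_{i}t_{i}=1$. Il appartient \`a
$Z(\hat{M}_{ad})^{\Gamma_{F},\hat{\theta}}$ si et seulement si les $t_{i}$ sont tous \'egaux. Il r\'esulte de cette description que notre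
homomorphisme est surjectif et que son noyau a $n$ \'el\'ements. Or $n$ est \'egal au d\'eterminant figurant dans l'assertion (2). » gives the
same number: the orbits of `⟨Γ_F, θ̂⟩` on the boundary roots are the pairs `{j, N-j}` with `n = 2` (`n = 1` at `j = N/2`), (16)/(D130).
[folklore] (proved here) [cite: Waldspurger2014StabilisationI, 3.3 l.1158-1165; Waldspurger2014StabilisationII, 1.12 l.990-992] -/
theorem mem_image_oneSubTheta_of_sq_eq_one (z : Fin k → C) (hz : alphaZ z = z)
    (hsq : ∀ i, z i * z i = 1) :
    ∃ (c : C) (u : Fin k → C), c * c = 1 ∧ z = (fun _ => c) * (u * (alphaZ u)⁻¹) := by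
  classical
  have hpal : ∀ i, z i.rev = z i := fun i =>
    (eq_inv_of_mul_eq_one_right ((alphaZ_eq_self_iff z).mp hz i)).trans
      (eq_inv_of_mul_eq_one_right (hsq i)).symm
  by_cases hm : ∃ m : Fin k, m.rev = m
  · obtain ⟨m, hm⟩ := hm
    refine ⟨z m, fun i => if i < i.rev then z i * (z m)⁻¹ else 1, hsq m, ?_⟩
    funext i
    simp only [Pi.mul_apply, Pi.inv_apply, alphaZ_apply, inv_inv, Fin.rev_rev]
    rcases lt_trichotomy i i.rev with h | h | h
    · rw [if_pos h, if_neg (not_lt.mpr h.le), mul_one, mul_comm (z i), ← mul_assoc, mul_inv_cancel,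
        one_mul]
    · rw [if_neg (by rw [← h]; exact lt_irrefl i), if_neg (by rw [← h]; exact lt_irrefl i), mul_one,
        mul_one, rev_eq_self_unique h.symm hm]
    · rw [if_neg (not_lt.mpr h.le), if_pos h, one_mul, mul_comm (z i.rev), ← mul_assoc,
        mul_inv_cancel, one_mul, hpal]
  · refine ⟨1, fun i => if i < i.rev then z i else 1, mul_one 1, ?_⟩
    funext i
    simp only [Pi.mul_apply, Pi.inv_apply, alphaZ_apply, inv_inv, Fin.rev_rev, one_mul]
    rcases lt_trichotomy i i.rev with h | h | h
    · rw [if_pos h, if_neg (not_lt.mpr h.le), mul_one]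
    · exact absurd ⟨i, h.symm⟩ hm
    · rw [if_neg (not_lt.mpr h.le), if_pos h, one_mul, hpal]

/-- §2 (10a). THE KERNEL, easy direction: an anti-palindromic `z` in `Z(Ĝ)·(1-θ̂)(Z(M̂)^{Γ_F})`
(constant times `u * (α u)⁻¹`) is `±1`-valued.  [folklore] (proved here) [cite: Waldspurger2014StabilisationI, 3.3 l.1158-1165] -/
theorem sq_eq_one_of_mem_image_oneSubTheta (z : Fin k → C) (hz : alphaZ z = z)
    (hmem : ∃ (c : C) (u : Fin k → C), z = (fun _ => c) * (u * (alphaZ u)⁻¹)) :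
    ∀ i, z i * z i = 1 := by
  obtain ⟨c, u, rfl⟩ := hmem
  exact sq_eq_one_of_mem_kernel _ hz ⟨c, u * (alphaZ u)⁻¹, isPalindromic_mul_alphaZ_inv u, rfl⟩

/-- §2 (11). ELLIPTICITY in the model.  With `y_ζ = 1` (8) the norm of `s̃ = (z,z)ζ̃` is `y = z²` (7c); `𝐆′(s̃)` is
elliptic iff `Z(Ĝ′(s̃))^{Γ_F}` is finite modulo `Z(Ĝ)^{Γ…}`, and `Z(Ĝ′) = ` scalars `c_λ` on the eigenspaces `E_λ` of `y`, on which `Γ_F`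
acts by `c_λ ↦ c_{λ⁻¹}⁻¹` (the eigenspaces of the anti-palindromic `y` come in pairs `λ, λ⁻¹`); so elliptic ⟺ every eigenvalue satisfies
`λ = λ⁻¹` ⟺ `y² = 1` ⟺ (this lemma) `z_i⁴ = 1` for all `i`; then `Ĝ′(s̃) = GL(E₊) × GL(E₋)` and `G′(s̃) = U(N₁) × U(N₂)` ([Mok] l.790
« (G^{\prime},\xi^{\prime}) =(U_{E/F}(N_1) \times U_{E/F}(N_2),\xi_{\underline{\chi}_{\underline{\kappa}}} ) »), `N₂ = dim E₋ = 2 Σ_{i ∈ B} n_i`,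
`B = {i ≤ r | z_i² = -1}`.  The hand computation of the `Γ_F`-action on `Z(Ĝ′)` is (D124); [II] 1.10's « \text{ si }{\bf G}'(s)\text{ est elliptique,} »
is typed in §3 only through the index sets.  [folklore] (proved here) [cite: Mok2012, §2.1 l.786-800; Waldspurger2014StabilisationII, 1.10 l.736-737, 1.12 l.984] -/
theorem normY_sq_isPMOne_iff (z : Fin k → C) :
    (∀ i, (z * z) i * (z * z) i = 1) ↔ ∀ i, z i ^ 4 = 1 := by
  simp only [Pi.mul_apply]
  constructor
  · intro h i; rw [show (4 : ℕ) = 2 + 2 by rfl, pow_add, pow_two]; exact h i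
  · intro h i; have := h i; rw [show (4 : ℕ) = 2 + 2 by rfl, pow_add, pow_two] at this; exact this

end BlockModel

/-! ## §3 The elliptic fine index sets and the count -/

section Count

variable (r : ℕ)

/-- §3 (12). The TYPE of an elliptic index: `t i = true` iff the `i`-th GL-block pair of `M′ = G_{E/F}(n₁) × ⋯ × G_{E/F}(n_r) × U(n₀)`
goes into the SECOND factor of `G′ = U(N₁) × U(N₂)`, `N₂ = 2 Σ_{t i} n_i`, `N₁ = n₀ + 2 Σ_{¬ t i} n_i`; it determines the pair (G′ ⊃ M′) up to
isomorphism ([I] 3.3 l.1147 « $M'$ s'identifie \`a un Levi de $G'(\tilde{s})$ »; [Mok] l.776 (untwisted) « The equivalence class of the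
endoscopic data is uniquely determined by $N_1,N_2$ », l.798 (twisted) « The equivalence class of the endoscopic datum $(G^{\prime},\xi^{\prime})$
is uniquely determined by the pair $(N_1,N_2)$ and $\underline{\kappa}$ »).  The signs `κ` are NOT part of the type (D125).
[cite: Mok2012, §2.1 l.772-800; Waldspurger2014StabilisationI, 3.3 l.1147] -/
abbrev EType := Fin r → Bool

/-- §3 (13). The FINE elliptic index set of [II] 4.3 (1) (l.2430 « $$(1) \qquad r_{\tilde{M}}^{\tilde{G},{\cal E}}({\bf
M}',\boldsymbol{\delta}',\tilde{K})=\sum_{\tilde{s}\in \tilde{\zeta}Z(\hat{M})^{\Gamma_{F},\hat{\theta}}/Z(\hat{G})^{\Gamma_{F},\hat{\theta}}}i_{\tilde{M}'}(\tilde{G},\tilde{G}'(\tilde{s}))s_{{\bf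
M}'}^{{\bf G}'(\tilde{s})}(\boldsymbol{\delta}',\tilde{K}).$$ ») for the principal `𝐌′`, `n₀ > 0` (`k = 2r+1`), BEFORE the quotient by
`Z(Ĝ)^{Γ_F,θ̂} = {±1}`: by (5)/(11) the elliptic `s̃ = (z,z)ζ̃` have `z_i ∈ μ₄` (`i ≤ r`) and a middle sign `ε`; written `(t, (s, ε))` with
`z_i = (√-1)^{t i} · (-1)^{s i}`.  The quotient by `±1` is replaced by the factor `1/2` in (15) (`negTw` (13b) is free).  (D126)
[cite: Waldspurger2014StabilisationII, 4.3 l.2425-2430, 1.12 l.979-984] -/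
abbrev FineIdxTw := (Fin r → Bool) × ((Fin r → Bool) × Bool)

/-- §3 (13a). The type of a twisted fine index is its `μ₄`-exponent parity vector `t` (`z_i² = (-1)^{t i}`): (11)/(12).
[cite: Waldspurger2014StabilisationII, 4.3 l.2430; Mok2012, §2.1 l.786-800] -/
def typeTw (x : FineIdxTw r) : EType r := x.1

/-- §3 (13b). The action of `-1 ∈ Z(Ĝ)^{Γ_F,θ̂}` on fine indices: all signs flip, the type is unchanged.
[cite: Waldspurger2014StabilisationII, 4.3 l.2425; Mok2012, §2.1 l.751] -/
def negTw (x : FineIdxTw r) : FineIdxTw r := (x.1, (fun i => !(x.2.1 i), !x.2.2))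

/-- §3 (13c). The `±1`-action on twisted fine indices is FREE. [folklore] (proved here; justifies the factor `1/2` of (15)) [cite: Waldspurger2014StabilisationII, 4.3 l.2425] -/
theorem negTw_ne (x : FineIdxTw r) : negTw r x ≠ x := by
  intro h
  have h2 := congrArg (fun y => y.2.2) h
  simp [negTw] at h2

/-- §3 (13d). The `±1`-action is an involution. [folklore] (proved here; helper) [cite: Waldspurger2014StabilisationII, 4.3 l.2425] -/
theorem negTw_negTw (x : FineIdxTw r) : negTw r (negTw r x) = x := by
  obtain ⟨t, s, e⟩ := x
  simp [negTw]

/-- §3 (13e). The `±1`-action preserves the type. [folklore] (proved here; helper) [cite: Waldspurger2014StabilisationII, 4.3 l.2425] -/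
theorem typeTw_negTw (x : FineIdxTw r) : typeTw r (negTw r x) = typeTw r x := rfl

/-- §3 (14). THE COEFFICIENT, both sides (the content of (β)).  Twisted, [II] 1.12 l.984 « $$i_{\tilde{M}'}(\tilde{G},\tilde{G}'(\tilde{s}))=[Z(\hat{M}')^{\Gamma_F}:(Z(\hat{M}')^{\Gamma_F}\cap
Z(\hat{M}))][Z(\hat{G}'(\tilde{s}))^{\Gamma_F}:(Z(\hat{G}'(\tilde{s}))^{\Gamma_F}\cap Z(\hat{G}))]^{-1}.$$ » (equivalently « (2)
$i_{\tilde{M}'}(\tilde{G},\tilde{G}'(\tilde{s}))$ est l'inverse du nombre d'\'el\'ements du noyau de (1). », l.1006): here `Z(M̂′) = {(c, α(c)) |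
c ∈ Z(L)} ⊂ Z(M̂)` (first index `1`) and `Z(Ĝ′(s̃))^{Γ_F} = {±1}^{#eigenvalues of y}`, `∩ Z(Ĝ) = {±1}`: `i = 1` if `y = ±1` (`G′ = U(N)`, type
`t ≡ false`), `i = 1/2` if `G′ = U(N₁) × U(N₂)` with `N₁ N₂ ≠ 0`.  Untwisted, [II] 1.10 l.737 « $$i_{\tilde{M}}(\tilde{G},\tilde{G}'(s))=\left\lbrace\begin{array}{cc}[Z(\hat{G}'(s))^{\Gamma_{F}}:Z(\hat{G})^{\Gamma_{F}}]^{-1},&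
\text{ si }{\bf G}'(s)\text{ est elliptique,}\\ 0,& \text{ sinon.}\\ \end{array}\right.$$ »: `[{±1}² : {±1}]⁻¹ = 1/2` for a proper product,
and the `s = 1` term of (4) (which is `r^{U(N)}_{M′}` itself) carries `1`.  SAME function of the type on both sides; `i₀ := i_{M̃′}(G̃, U(N)) = 1`.
The two index computations are by hand (D128).  [cite: Waldspurger2014StabilisationII, 1.10 l.736-737, 1.12 l.984, l.1003-1006, 4.2 l.2413] -/
def coef (t : EType r) : ℚ := if t = (fun _ => false) then 1 else 1 / 2

/-- §3 (15). The TWISTED endoscopic side of [II] 4.3 (1) as a formal combination of types: the total coefficient with which the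
stable term of type `t` occurs, `(1/2) · Σ_{fine indices of type t} i(s̃)` (the `1/2` implements `/Z(Ĝ)^{Γ_F,θ̂}`, (13)).
[cite: Waldspurger2014StabilisationII, 4.3 l.2430, 1.12 l.984] -/
def endoTw (t : EType r) : ℚ :=
  (1 / 2) * ∑ x : FineIdxTw r, (if typeTw r x = t then coef r t else 0)

/-- §3 (15a). `#(sign vectors × middle sign) = 2^r · 2`. [folklore] (proved here; helper) [cite: Waldspurger2014StabilisationI, 3.3 l.1160-1165] -/
theorem card_signCover : Fintype.card ((Fin r → Bool) × Bool) = 2 ^ r * 2 := by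
  simp [Fintype.card_prod, Fintype.card_bool]

/-- §3 (15b). Summing a function of the type over twisted fine indices = `2^r · 2` times the sum over types.
[folklore] (proved here; helper) [cite: Waldspurger2014StabilisationII, 4.3 l.2430] -/
theorem sum_typeTw (f : EType r → ℚ) :
    ∑ x : FineIdxTw r, f (typeTw r x) = (2 ^ r * 2 : ℕ) • ∑ t : EType r, f t := by
  rw [Fintype.sum_prod_type]
  simp only [typeTw]
  rw [Finset.smul_sum]
  refine Finset.sum_congr rfl fun t _ => ?_
  rw [Finset.sum_const, Finset.card_univ, card_signCover]

/-- §3 (15c). THE TWISTED MULTIPLICITY: the stable term of type `t` occurs in [II] 4.3 (1) with total coefficient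
`2^r · coef t` — every elliptic pair (G′ ⊃ M′) is hit by `2^r` fine indices modulo `±1` (`r` free signs `s`, the middle sign `ε`, modulo the
diagonal `-1`).  In particular `G′(s̃) = U(N)` for `2^r` classes of fine indices, not only for `s̃ = ζ̃`.  This `2^r` is `|det(1-θ^{M̃})|` of
[I] 3.3 (2) / [II] 1.12 Remarque (l.990 « {\bf Remarque.} Conform\'ement \`a [I] 3.3(2), en supposant $\hat{M}$ standard, on pourrait aussi
sommer sur » … « (ou plus canoniquement sur $\tilde{\zeta}Z(\hat{M})^{\Gamma_F}/Z(\hat{G})^{\Gamma_F}$ \`a conjugaison pr\`es par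
$Z(\hat{M})^{\Gamma_{F}}$) \`a condition de multiplier les coefficients par $\vert det((1-\theta^{\tilde{M}})_{{\cal A}_{M}/({\cal
A}_{\tilde{M}}+{\cal A}_{G}})\vert $. »).  [folklore] (proved here) [cite: Waldspurger2014StabilisationII, 4.3 l.2430, 1.12 l.984, l.990-992; Waldspurger2014StabilisationI, 3.3 l.1160-1163] -/
theorem endoTw_eq (t : EType r) : endoTw r t = 2 ^ r * coef r t := by
  unfold endoTw
  have h := sum_typeTw r (fun u => if u = t then coef r t else 0)
  simp only [typeTw] at h ⊢
  rw [h, Finset.sum_ite_eq' Finset.univ t, if_pos (Finset.mem_univ t), nsmul_eq_mul]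
  push_cast
  ring

/-- §3 (17). The UNTWISTED fine index set for `U(N) ⊃ M′` ([II] 4.2 (4), l.2413 « $$(4) \qquad
s_{\tilde{M}}^{\tilde{G}}(\boldsymbol{\delta},\tilde{K})=r_{\tilde{M}}^{\tilde{G}}(\boldsymbol{\delta},\tilde{K})-\sum_{s\in Z(\hat{M})^{\Gamma_{F}}/Z(\hat{G})^{\Gamma_{F}},
s\not=1}i_{\tilde{M}}(\tilde{G},\tilde{G}'(s))s_{{\bf M}}^{{\bf G}'(s)}(\boldsymbol{\delta},\tilde{K}).$$ », applied to the quasi-split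
group `U(N)` in the role of `G̃`), restricted to its ELLIPTIC locus: `Z(M̂_U)^{Γ_F}` is the group of anti-palindromic block scalars
(`α z = z`, §2 (5): `(ℂ^×)^r × {±1}` for `C = ℂ^×`), `𝐆′(s)` is elliptic iff every `z_i = ±1` (eigenvalues of `s` in `{±1}`, as in §2 (11)),
and the other indices carry the coefficient `0` ([II] 1.10 « 0,& \text{ sinon.} »); so the set summed over is `{±1}^r × {±1}` (signs `z` on
the GL-pairs, `ε` on `U(n₀)`), before the quotient by `Z(Û(N))^{Γ_F} = {±1}`; the `s = 1` term is kept (it is `r^{U(N)}_{M′}`, coefficient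
`1`: (4) solved for `r`).  (D127); v1's wording “`Z(M̂_U)^{Γ_F} = {±1}^r × {±1}` … elliptic throughout” was an erratum (v1.1).
[cite: Waldspurger2014StabilisationII, 4.2 l.2413, 1.10 l.736-737; Mok2012, §2.1 l.772-780] -/
abbrev FineIdxUn := (Fin r → Bool) × Bool

/-- §3 (17a). The type of an untwisted index `(z, ε)`: block pair `i` lies in the factor NOT containing `U(n₀)` iff `z i ≠ ε`
(`Ĝ′(s) = Z_{GL_N}(s)`, eigenvalue `ε` on the `U(n₀)`-block).  [cite: Waldspurger2014StabilisationII, 1.10 l.736-737; Mok2012, §2.1 l.772-780] -/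
def typeUn (x : FineIdxUn r) : EType r := fun i => x.1 i != x.2

/-- §3 (17b). The action of `-1 ∈ Z(Û(N))^{Γ_F}`: all signs flip. [cite: Waldspurger2014StabilisationII, 4.2 l.2413] -/
def negUn (x : FineIdxUn r) : FineIdxUn r := (fun i => !(x.1 i), !x.2)

/-- §3 (17c). The `±1`-action on untwisted indices is free. [folklore] (proved here; helper) [cite: Waldspurger2014StabilisationII, 4.2 l.2413] -/
theorem negUn_ne (x : FineIdxUn r) : negUn r x ≠ x := by
  intro h
  have h2 := congrArg (fun y => y.2) h
  simp [negUn] at h2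

/-- §3 (17d). The `±1`-action on untwisted indices preserves the type. [folklore] (proved here; helper) [cite: Waldspurger2014StabilisationII, 4.2 l.2413] -/
theorem typeUn_negUn (x : FineIdxUn r) : typeUn r (negUn r x) = typeUn r x := by
  funext i
  obtain ⟨z, e⟩ := x
  simp only [typeUn, negUn]
  cases z i <;> cases e <;> rfl

/-- §3 (17e). Untwisted indices ≃ (type, ε): each type is hit exactly twice, i.e. ONCE modulo `±1` — Rogawski's/[Mok]'s list
of elliptic data `U(N₁) × U(N₂) ⊃ M′` without repetition ([Mok] l.772 « Thus $G=U_{E/F}(N)$. The set $\mathcal{E}_{\ellip}(G)$ of (equivalence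
classes of) elliptic endoscopic data of $G=U_{E/F}(N)$ are determined by Rogawski (\cite{R} section 4.6). They are given by »
« (G^{\prime},\xi^{\prime}) = (U_{E/F}(N_1) \times U_{E/F}(N_2), \zeta_{\underline{\chi}}) »).  [folklore] (proved here)
[cite: Mok2012, §2.1 l.772-780; Waldspurger2014StabilisationII, 4.2 l.2413] -/
def typeUnEquiv : FineIdxUn r ≃ (EType r × Bool) where
  toFun x := (typeUn r x, x.2)
  invFun y := (fun i => xor (y.1 i) y.2, y.2)
  left_inv x := by
    obtain ⟨z, e⟩ := x
    simp only [Prod.mk.injEq, and_true]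
    funext i
    simp only [typeUn]
    cases z i <;> cases e <;> rfl
  right_inv y := by
    obtain ⟨t, e⟩ := y
    simp only [Prod.mk.injEq, and_true]
    funext i
    simp only [typeUn]
    cases t i <;> cases e <;> rfl

/-- §3 (17f). Summing a function of the type over untwisted indices = `2` times the sum over types. [folklore] (proved here; helper) [cite: Waldspurger2014StabilisationII, 4.2 l.2413] -/
theorem sum_typeUn (f : EType r → ℚ) :
    ∑ x : FineIdxUn r, f (typeUn r x) = 2 • ∑ t : EType r, f t := by
  have h : ∑ x : FineIdxUn r, f (typeUn r x) = ∑ y : EType r × Bool, f y.1 := by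
    refine Fintype.sum_equiv (typeUnEquiv r) _ _ fun x => rfl
  rw [h, Fintype.sum_prod_type, Finset.smul_sum]
  refine Finset.sum_congr rfl fun t _ => ?_
  show ∑ _e : Bool, f t = 2 • f t
  rw [Finset.sum_const, Finset.card_univ, Fintype.card_bool]

/-- §3 (18). The UNTWISTED endoscopic expansion of `r^{U(N)}_{M′}(δ′, K)` by [II] 4.2 (4), as a formal combination of types (factor
`1/2` for `/Z(Û(N))^{Γ_F}`).  [cite: Waldspurger2014StabilisationII, 4.2 l.2413, 1.10 l.736-737] -/
def endoUn (t : EType r) : ℚ :=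
  (1 / 2) * ∑ x : FineIdxUn r, (if typeUn r x = t then coef r t else 0)

/-- §3 (18a). THE UNTWISTED MULTIPLICITY: type `t` occurs with total coefficient `coef t` (once per class).
[folklore] (proved here) [cite: Waldspurger2014StabilisationII, 4.2 l.2413, 1.10 l.736-737; Mok2012, §2.1 l.772-780] -/
theorem endoUn_eq (t : EType r) : endoUn r t = coef r t := by
  unfold endoUn
  have h := sum_typeUn r (fun u => if u = t then coef r t else 0)
  rw [h, Finset.sum_ite_eq' Finset.univ t, if_pos (Finset.mem_univ t), nsmul_eq_mul]
  push_cast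
  ring

/-- §3 (19). (α)/(β) OF Q-UP-61-a, PRECISE FORM (`n₀ > 0`): as formal combinations of elliptic pairs
(G′ ⊃ M′), [II] 4.3 (1)'s twisted endoscopic side for the principal `𝐌′` equals `2^r` times [II] 4.2 (4)'s untwisted expansion of
`r^{U(N)}_{M′}` — type by type, `endoTw r t = 2^r * endoUn r t`.  So « the SAME endoscopic groups » (G-UP-704 (α)) holds on CLASSES with the
uniform multiplicity `2^r = |det(1-θ^{M̃}; 𝒜_M/(𝒜_{M̃}+𝒜_G))|`, not on the fine index set, and (β) holds with `i₀ = 1`.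
[folklore] (proved here) [cite: Waldspurger2014StabilisationII, 4.3 l.2430, 4.2 l.2413, 1.12 l.984-992; Waldspurger2014StabilisationI, 3.3 l.1160-1163] -/
theorem endoTw_eq_two_pow_mul_endoUn (t : EType r) : endoTw r t = 2 ^ r * endoUn r t := by
  rw [endoTw_eq, endoUn_eq]

/-- §3 (16). The kernel of [I] 3.3 (2) in the model (`n₀ > 0`), counted: `(2^r · 2)/2 = 2^r` (cf. (10)).
[folklore] (proved here) [cite: Waldspurger2014StabilisationI, 3.3 l.1160-1165] -/
theorem card_kernelCover : Fintype.card ((Fin r → Bool) × Bool) / 2 = 2 ^ r := by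
  rw [card_signCover]; omega

/-- §3 (16a). MW's orbit count for `k = 2r+1` blocks: `2r` boundary roots, no `θ̂Γ`-fixed one, `(2r - 0)/2 = r`
orbits with `n = 2`, `|det| = 2^r` ([I] 3.3 proof, l.1165 « son noyau a $n$ \'el\'ements. Or $n$ est \'egal au d\'eterminant figurant dans
l'assertion (2). »).  Arithmetic only (D130). [folklore] (proved here) [cite: Waldspurger2014StabilisationI, 3.3 l.1165] -/
theorem mw_kernel_exponent_odd : (2 * r + 1 - 1 - 0) / 2 = r := by omega

/-- §3 (16b). MW's orbit count for `k = 2r` blocks (`n₀ = 0`, `r ≥ 1`): `2r - 1` boundary roots, the middle one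
`θ̂Γ`-fixed (`n = 1`), `(2r-1-1)/2 = r-1` orbits with `n = 2`, `|det| = 2^{r-1}`.  Arithmetic only (D130).
[folklore] (proved here) [cite: Waldspurger2014StabilisationI, 3.3 l.1165] -/
theorem mw_kernel_exponent_even (hr : 0 < r) : (2 * r - 1 - 1) / 2 = r - 1 := by omega

/-- §3 (20). `n₀ = 0` (`k = 2r`, e.g. the Siegel Levi): twisted fine elliptic indices `(t, s)` (no middle sign); now the types
`t` and `¬t` give ISOMORPHIC pairs (swap the two unitary factors; [Mok] l.798 « These endoscopic data are mutually inequivalent, except for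
the case where $N_1=N_2$, in which case the data $(U(N_1) \times U(N_1), (1,-1))$ and $(U(N_1) \times U(N_1),  (-1,1) )  $ are equivalent. »
concerns the `κ`-signed data, not modelled), so classes of pairs are unordered types `{t, ¬t}` (D132).
[cite: Mok2012, §2.1 l.786-820; Waldspurger2014StabilisationII, 4.3 l.2430] -/
abbrev FineIdxTw₀ := (Fin r → Bool) × (Fin r → Bool)

/-- §3 (20a). Coefficient for `n₀ = 0`: `1` iff `G′ = U(N)` iff `t` is constant (`y = +1` or `y = -1`), else `1/2` ((14)).
[cite: Waldspurger2014StabilisationII, 1.12 l.984, 1.10 l.736-737] -/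
def coef₀ (t : EType r) : ℚ := if (t = fun _ => false) ∨ (t = fun _ => true) then 1 else 1 / 2

/-- §3 (20b). `coef₀` is invariant under `t ↦ ¬t`. [folklore] (proved here; helper) [cite: Waldspurger2014StabilisationII, 1.12 l.984] -/
theorem coef₀_not (t : EType r) : coef₀ r (fun i => !(t i)) = coef₀ r t := by
  unfold coef₀
  have h1 : ((fun i => !(t i)) = fun _ => false) ↔ (t = fun _ => true) := by
    constructor
    · intro h; funext i; have := congrFun h i; simpa using this
    · intro h; funext i; rw [h]; rfl
  have h2 : ((fun i => !(t i)) = fun _ => true) ↔ (t = fun _ => false) := by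
    constructor
    · intro h; funext i; have := congrFun h i; simpa using this
    · intro h; funext i; rw [h]; rfl
  simp only [h1, h2, or_comm]

/-- §3 (20c). Twisted endoscopic side for `n₀ = 0`, as a formal combination of ORDERED types (factor `1/2` for `/±1`).
[cite: Waldspurger2014StabilisationII, 4.3 l.2430] -/
def endoTw₀ (t : EType r) : ℚ :=
  (1 / 2) * ∑ x : FineIdxTw₀ r, (if x.1 = t then coef₀ r t else 0)

/-- §3 (20d). `n₀ = 0`: ordered type `t` carries `2^r · coef₀ t / 2`. [folklore] (proved here) [cite: Waldspurger2014StabilisationII, 4.3 l.2430, 1.12 l.984] -/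
theorem endoTw₀_eq (t : EType r) : endoTw₀ r t = 2 ^ r * coef₀ r t / 2 := by
  unfold endoTw₀
  have h : ∑ x : FineIdxTw₀ r, (if x.1 = t then coef₀ r t else 0)
      = ∑ y : EType r, (2 ^ r : ℕ) • (if y = t then coef₀ r t else 0) := by
    rw [Fintype.sum_prod_type]
    refine Finset.sum_congr rfl fun y _ => ?_
    show ∑ _s : Fin r → Bool, (if y = t then coef₀ r t else 0) = _
    rw [Finset.sum_const, Finset.card_univ, Fintype.card_fun, Fintype.card_bool, Fintype.card_fin]
  rw [h, ← Finset.smul_sum, Finset.sum_ite_eq' Finset.univ t, if_pos (Finset.mem_univ t), nsmul_eq_mul]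
  push_cast
  ring

/-- §3 (20e). `n₀ = 0`: the unordered class `{t, ¬t}` carries `2^r · coef₀ t` on the twisted side — here `2^r = 2 · |det|`,
`|det| = 2^{r-1}` ((16b)), the extra `2` being `t ∼ ¬t` (D132).  For `r = 1` (Siegel Levi, `M′ = G_{E/F}(N/2)`): both fine classes have
`G′ = U(N)`, total `2` — the model's form of [Mok] l.817 « for example for the Siegel Levi $M \cong G_{E/F}(N/2)$, the two Levi sub-data
$(M,\xi_{\chi_+})$ and $(M,\xi_{\chi_-})$ are equivalent as twisted endoscopic datum of $\widetilde{G}_{E/F}(N)$ » « in fact any Levi $M$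
with such property is a subgroup of the Siegel Levi. ».  [folklore] (proved here) [cite: Mok2012, §2.1 l.815-820; Waldspurger2014StabilisationII, 4.3 l.2430] -/
theorem endoTw₀_class (t : EType r) :
    endoTw₀ r t + endoTw₀ r (fun i => !(t i)) = 2 ^ r * coef₀ r t := by
  rw [endoTw₀_eq, endoTw₀_eq, coef₀_not]
  ring

/-- §3 (20f). Untwisted expansion for `n₀ = 0` (elliptic indices `z ∈ {±1}^r ⊂ Z(M̂_U)^{Γ_F}`, type = `z` up to the global sign),
ordered types.
[cite: Waldspurger2014StabilisationII, 4.2 l.2413] -/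
def endoUn₀ (t : EType r) : ℚ :=
  (1 / 2) * ∑ z : Fin r → Bool, (if z = t then coef₀ r t else 0)

/-- §3 (20g). `n₀ = 0`: the unordered class `{t, ¬t}` carries `coef₀ t` on the untwisted side. [folklore] (proved here) [cite: Waldspurger2014StabilisationII, 4.2 l.2413, 1.10 l.736-737] -/
theorem endoUn₀_class (t : EType r) :
    endoUn₀ r t + endoUn₀ r (fun i => !(t i)) = coef₀ r t := by
  unfold endoUn₀
  rw [Finset.sum_ite_eq' Finset.univ t, if_pos (Finset.mem_univ t),
    Finset.sum_ite_eq' Finset.univ (fun i => !(t i)), if_pos (Finset.mem_univ _), coef₀_not]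
  ring

/-- §3 (20h). (α)/(β) for `n₀ = 0` on unordered classes: twisted = `2^r` · untwisted.
[folklore] (proved here) [cite: Waldspurger2014StabilisationII, 4.3 l.2430, 4.2 l.2413; Waldspurger2014StabilisationI, 3.3 l.1160-1163] -/
theorem endoTw₀_class_eq_two_pow_mul (t : EType r) :
    endoTw₀ r t + endoTw₀ r (fun i => !(t i)) = 2 ^ r * (endoUn₀ r t + endoUn₀ r (fun i => !(t i))) := by
  rw [endoTw₀_class, endoUn₀_class]

/-- §3 (21). Worked instance `r = 1`, `n₀ > 0` (`M′ = G_{E/F}(n₁) × U(n₀) ⊂ U(N)`): twisted coefficients `2` at `U(N)` and `1` at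
`U(n₀) × U(2n₁)`; untwisted `1` and `1/2`.  [folklore] (proved here; sanity instance) [cite: Waldspurger2014StabilisationII, 4.3 l.2430, 4.2 l.2413] -/
example : endoTw 1 (fun _ => false) = 2 ∧ endoTw 1 (fun _ => true) = 1 ∧
    endoUn 1 (fun _ => false) = 1 ∧ endoUn 1 (fun _ => true) = 1 / 2 := by
  refine ⟨?_, ?_, ?_, ?_⟩ <;> simp [endoTw_eq, endoUn_eq, coef] <;> norm_num [funext_iff]

/-- §3 (21a). Worked instance `r = 1`, `n₀ = 0` (Siegel): the single unordered class `{U(N)}` carries `2` (twisted) vs `1`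
(untwisted) — [Mok] l.817's two equivalent Siegel sub-data.  [folklore] (proved here; sanity instance) [cite: Mok2012, §2.1 l.815-820] -/
example : endoTw₀ 1 (fun _ => false) + endoTw₀ 1 (fun _ => true) = 2 ∧
    endoUn₀ 1 (fun _ => false) + endoUn₀ 1 (fun _ => true) = 1 := by
  have h1 := endoTw₀_class 1 (fun _ => false)
  have h2 := endoUn₀_class 1 (fun _ => false)
  simp only [Bool.not_false] at h1 h2
  refine ⟨?_, ?_⟩
  · rw [h1]; simp [coef₀]
  · rw [h2]; simp [coef₀]

end Count

/-! ## §4 `|det(1-θ)|` on `𝒜_M/(𝒜_{M̃}+𝒜_G)`: an involution acts as `2` modulo its fixed vectors -/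

section Det

variable {R V : Type*} [CommRing R] [AddCommGroup V] [Module R V]

/-- §4 (22). Behind `|det(1-θ^{M̃}; 𝒜_M/(𝒜_{M̃}+𝒜_G))| = 2^r`: for ANY involutive linear
map `θ` on a module, `(1-θ)v = 2v - w` with `θ w = w` (`w = v + θ v`), i.e. `1-θ` is multiplication by `2` modulo the `θ`-fixed vectors.
Application (prose only, (D130)): `𝒜_M = ℝ^k` (one coordinate per block of `L`, `M(F) = L(E)`), `θ^{M̃} = -rev` ([I] 3.3 l.1158 « On y note
$\theta^{\tilde{M}}$ l'automorphisme de ${\cal A}_{M}$ induit par $ad_{\gamma}$ pour n'importe quel $\gamma\in \tilde{M}$. »), `𝒜_{M̃} =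
𝒜_M^θ` = anti-palindromic vectors (dimension `r`), `𝒜_G` = constants (where `θ = -1`; `𝒜_{G̃} = 0`); the quotient has dimension
`k - r - 1 = ⌈k/2⌉ - 1` and `θ = -1` on it, so `det(1-θ) = 2^r` for `k = 2r+1` and `2^{r-1}` for `k = 2r` — the numbers of (16a)/(16b) and
of MW's orbit count.  The space `𝒜_M` is not constructed here.  [folklore] (proved here) [cite: Waldspurger2014StabilisationI, 3.3 l.1158-1165] -/
theorem one_sub_invol_eq_two_smul_sub_fixed (θ : V →ₗ[R] V) (hθ : ∀ v, θ (θ v) = v) (v : V) :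
    ∃ w : V, θ w = w ∧ v - θ v = (2 : R) • v - w := by
  refine ⟨v + θ v, ?_, ?_⟩
  · rw [map_add, hθ, add_comm]
  · rw [two_smul]; abel

end Det

/-! ## §5 The typed statements and the edge -/

section Statements

variable (r : ℕ)

/-- §5 (23). THE NUMBERS OF THE PRINCIPAL SLICE at [Mok]'s datum (`G̃ = G̃_{E/F}(N)`, `E/F` unramified, `p` large as in [II] 4.1
l.2362 « Le groupe $G(F)$ est muni d'une mesure canonique pour laquelle $mes(K)=1$ pour tout sous-groupe compact hypersp\'ecial $K$ de $G(F)$ »;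
`M̃ ↔ L × L` with `r` GL-block pairs and `n₀ > 0`; `𝐌′` principal; `δ′ ∈ D^{st}_{géom}(𝐌′)` with strongly `G̃`-regular support), packaged as
OPAQUE complex numbers indexed by the type (D129): no measure, integral or transfer factor is constructed, so every identity below is an
identity between these numbers under NAMED hypotheses.  [cite: Waldspurger2014StabilisationII, 4.1 l.2362-2365, 4.2 l.2413, 4.3 l.2423-2430, 4.4 l.2436-2441; Kottwitz1986BaseChangeUnits, §3 p. 247-248] -/
structure SliceData where
  /-- `sTw t` = [II] 4.3's `s^{𝐆′(s̃)}_{𝐌′}(δ′, K̃)` for (any) fine index `s̃` of type `t`, l.2427 « On fixe un sous-espace hypersp\'ecial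
$\tilde{K}'_{1}(\tilde{s})$ de $\tilde{G}'_{1}(\tilde{s};F)$ se projetant sur un espace $\tilde{K}'(\tilde{s})$ de $\tilde{G}'(\tilde{s};F)$
associ\'e \`a $\tilde{K}$. On utilise le facteur de transfert associ\'e \`a cet espace. » — that it depends on `s̃` only through the type is
the hypothesis `PairInvariance` (26). [cite: Waldspurger2014StabilisationII, 4.3 l.2425-2430] -/
  sTw : (Fin r → Bool) → ℂ
  /-- `sUn t` = [II] 4.2's stable term `s^{𝐆′(s)}_{𝐌′}(δ′, K)` on the untwisted side for the pair of type `t` (`U(N) ⊃ G′(s) ⊃ M′`),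
with `sUn (fun _ ↦ false) = s^{U(N)}_{M′}(δ′, K)` itself; l.2379 « (1) $s_{\tilde{M}}^{\tilde{G}}(.,\tilde{K})$ ne d\'epend que de la classe
de conjugaison de $\tilde{K}$ par $G_{AD}(F)$. » [cite: Waldspurger2014StabilisationII, 4.2 l.2374-2381, l.2413] -/
  sUn : (Fin r → Bool) → ℂ
  /-- `rTw` = `r^{G̃}_{M̃}(transfert(δ′), K̃) = J^{G̃}_{M̃}(transfert(δ′), 1_{K̃})` ([II] 4.1 l.2365; the right side of Thm 4.4), in
[II]'s measures ([II] 1.2; 4.3 l.2425 « Supposons-la elliptique. Alors ${\cal A}_{M'}^{G'(\tilde{s})}\simeq {\cal A}_{\tilde{M}}^{\tilde{G}}$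
et on  choisit pour mesure sur le premier espace l'image par cet isomorphisme de la mesure fix\'ee sur le second. »).
[cite: Waldspurger2014StabilisationII, 4.1 l.2365, 4.3 l.2425, 4.4 l.2439] -/
  rTw : ℂ
  /-- `rUn` = `r^{U(N)}_{M′}(δ′, K) = J^{U(N)}_{M′}(δ′, 1_K)`, the untwisted weighted unit integral on `U(N)` with the measure on
`𝒜^{U(N)}_{M′}` transported from `𝒜^{G̃}_{M̃}` (4.3 at `s̃ = ζ̃`). [cite: Waldspurger2014StabilisationII, 4.1 l.2365, 4.2 l.2413, 4.3 l.2425] -/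
  rUn : ℂ
  /-- `ktTw` = Kottwitz's `Φ`-twisted weighted unit orbital integral `WO_{δθ}(f_E)` with the weight `v_M|_{G(E)}` ([Kt_1] p. 248
« After working through Arthur’s definition is twisted weighted orbital integrals, one finds that the necessary weight function on G(E) is
none other than the restriction of VM to G(E) (up to a scalar which will be 1 in a suitable normalization). » [OCR sic: « is » = of,
« VM » = v_M]). [cite: Kottwitz1986BaseChangeUnits, §3 p. 248] -/
  ktTw : ℂ
  /-- `ktUn` = Kottwitz's `WO_γ(f)` on `G(F) = U(N)(F)` with Arthur's weight ([Kt_1] p. 248 « It is obvious that the restriction of vm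
to G(F) is the weight function on G ( F ) that Arthur uses to define weighted orbital integrals. » [OCR sic: « vm » = v_M]), `γ ↔ δ` related
for `M` (p. 248 « Suppose that our elements y E M(F) and 8 E M(E) are related by the correspondence » [OCR sic: « y E » = γ ∈, « 8 E » = δ ∈]).
[cite: Kottwitz1986BaseChangeUnits, §3 p. 247-248] -/
  ktUn : ℂ

variable {r}

/-- §5 (24). The LEFT side of [II] Thm 4.4 for the principal `𝐌′` in the model: `r^{G̃,𝓔}_{M̃}(𝐌′, δ′, K̃) = Σ_t endoTw t ·
sTw t` ((13)–(15); under `PairInvariance` the fine sum (1) of 4.3 collapses to this sum over types).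
[cite: Waldspurger2014StabilisationII, 4.3 l.2430, 4.4 l.2436-2439] -/
def endoSideTw (W : SliceData r) : ℂ := ∑ t : EType r, (endoTw r t : ℂ) * W.sTw t

/-- §5 (24a). The right side of [II] 4.2 (4) solved for `r^{U(N)}_{M′}`: `Σ_t endoUn t · sUn t = sUn(false) + Σ_{t proper}
(1/2) sUn t` ((28)). [cite: Waldspurger2014StabilisationII, 4.2 l.2413] -/
def endoSideUn (W : SliceData r) : ℂ := ∑ t : EType r, (endoUn r t : ℂ) * W.sUn t

/-- §5 (25). [II] THÉORÈME 4.4, PRINCIPAL SLICE, in the model: l.2437 « \ass{Th\'eor\`eme}{Soit $\tilde{M}$ un espace de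
Levi de $\tilde{G}$ en bonne position relativement \`a $K$. Soit ${\bf M}'$ une donn\'ee endoscopique elliptique et non ramifi\'ee de
$\tilde{M}$. » « $$r_{\tilde{M}}^{\tilde{G},{\cal E}}({\bf M}',\boldsymbol{\delta}',\tilde{K})=r_{\tilde{M}}^{\tilde{G}}(transfert(\boldsymbol{\delta}'),\tilde{K}).$$ »
(l.2441 « Dans ce cas, l'assertion est le lemme fondamental pond\'er\'e sous sa forme usuelle. Elle est maintenant prouv\'ee d'apr\`es [W3]
th\'eor\`eme 3.8. » — the audit's row L09, M56 `TWFL`), specialised to `G̃ = G̃_{E/F}(N)`, `𝐌′` principal: `endoSideTw W = W.rTw`.  A `Prop`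
about the opaque numbers (D129); NOT asserted.  [cite: Waldspurger2014StabilisationII, 4.4 l.2436-2441, 4.3 l.2430] -/
def MW44PrincipalSlice (W : SliceData r) : Prop := endoSideTw W = W.rTw

/-- §5 (25a). [II] 4.2 (4) for `(U(N), M′)` (quasi-split, « \`a torsion int\'erieure », l.2374 « On suppose ici $(G,\tilde{G},{\bf
a})$ quasi-d\'eploy\'e et \`a torsion int\'erieure. »), solved for `r`: `W.rUn = endoSideUn W`.  A DEFINITION in [II] (by induction), typed
as a hypothesis on the opaque numbers.  [cite: Waldspurger2014StabilisationII, 4.2 l.2374-2376, l.2413] -/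
def MW42Def4 (W : SliceData r) : Prop := W.rUn = endoSideUn W

/-- §5 (26). HYPOTHESIS (γ′) “pair invariance”: the stable term attached by [II] 4.3 to a fine index `s̃` of type `t`
(auxiliary data `G′₁(s̃)`, hyperspecial `K̃′(s̃)` associated to `K̃`, its transfer factor) equals the untwisted stable term of [II] 4.2 for the
pair `U(N) ⊃ G′(s) ⊃ M′` of the same type.  IN PRINT modulo the model's identification of pairs by type (D125): both are the canonical
`s^{G′}_{M′}(δ′, ·)` of the group `G′ = U(N₁) × U(N₂)` (simply connected derived group, so no auxiliary extension is needed; `𝓖′ ≅ {}^L G′` by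
[Mok]'s `ξ_χ`), evaluated at the SAME `δ′ ∈ M′(F)` and at hyperspecial subgroups, on whose `G′_{AD}(F)`-class alone it depends ([II] 4.2 (1),
l.2381 « deux sous-groupes hypersp\'eciaux de $G(F)$ sont toujours conjugu\'es par $G_{AD}(F)$ »); and [I] 3.3 l.1151 « On voit que le
bifacteur de transfert pour la donn\'ee ${\bf M}'$ co\"{\i}ncide avec la restriction \`a ${\cal D}({\bf M}')\times {\cal D}({\bf M}')$ du
bifacteur de transfert pour la donn\'ee ${\bf G}'(\tilde{s})$. ».  Kept as a NAMED hypothesis because the identification of pairs is the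
model's, not a typed theorem (GAPS G-TY-52-3 (γ′)).  [cite: Waldspurger2014StabilisationII, 4.2 l.2379-2381, 4.3 l.2425-2428; Waldspurger2014StabilisationI, 3.3 l.1151] -/
def PairInvariance (W : SliceData r) : Prop := ∀ t, W.sTw t = W.sUn t

/-- §5 (27). [Kt_1] §3 (p. 247 « We return to the situation in the introduction, so that G is again unramified. » « Let M be a
Levi subgroup of G over o. »; p. 248, the twisted-weighted unit matching `WO_{δθ}(f_E) = WO_γ(f)` for `γ ↔ δ` related for `M` — the display
itself is lost in the text layer; « The proof is a slight variant of the proof that » [the unweighted unit identity]), at `G = U(N)_{F}`,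
`E/F` the unramified quadratic extension (registered first-hand by M115 §§8/18 and M207 §1; here only its two sides as numbers): `W.ktTw =
W.ktUn`.  NOT asserted.  [cite: Kottwitz1986BaseChangeUnits, §3 p. 247-248] -/
def Kt1Sec3 (W : SliceData r) : Prop := W.ktTw = W.ktUn

/-- §5 (27a). HYPOTHESIS (δ′) “one constant”: [II]'s `r^{G̃}_{M̃}(transfert(δ′), K̃)` and `2^r · r^{U(N)}_{M′}(δ′, K)`
are Kottwitz's `WO_{δθ}(f_E)` and `WO_γ(f)` up to ONE common non-zero constant `c` — i.e. the dictionary between [II]'s measures (1.2: a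
quadratic form on `X_*(T^*) ⊗ ℝ`, 1.12 l.985 « Pour cela, on a fix\'e une forme quadratique sur $X_{*}(T^*)\otimes {\mathbb R}$. » … « On
choisit pour forme quadratique sur le premier espace  la restriction au second de la forme que l'on a fix\'ee. »; 4.3's transport
`𝒜^{G′}_{M′} ≃ 𝒜^{G̃}_{M̃}`; `transfert` of the principal unramified datum with [I] 6.2–6.3's normalised factors) and Kottwitz's (p. 247 « We
write » 𝔞_M « Homz(HomF(M, Gm), R) » [OCR sic], `H_M` through « Here we have extended the normalized absolute value on F’ to an absolute
value on Lx. » [OCR sic], one weight `v_M` on `G(L)` restricted to `G(E)` and to `G(F)`, p. 248 « up to a scalar which will be 1 in a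
suitable normalization ») absorbs exactly the factor `2^r` of (19).  A natural candidate for the `2^r`: the index `2` per GL-block pair of
`Hom(X^*(M_E), ℤ)^θ` over the image of `Hom(X^*(M)_F, ℤ)`-type lattices (`r` pairs) — NOT adjudicated by the cell (GAPS G-TY-52-3 (δ′)).
That (γ′) `PairInvariance`, (δ′) `Normalisation` and [II] 4.2 (4) (`MW42Def4`) enter as HYPOTHESES on opaque numbers, not as theorems or
unfolding definitions, is divergence (D131).
[cite: Waldspurger2014StabilisationII, 1.12 l.985, 4.3 l.2425; Kottwitz1986BaseChangeUnits, §3 p. 247-248] -/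
def Normalisation (W : SliceData r) : Prop :=
  ∃ c : ℂ, c ≠ 0 ∧ W.rTw = c * W.ktTw ∧ (2 : ℂ) ^ r * W.rUn = c * W.ktUn

/-- §5 (28). Under `PairInvariance`, the twisted endoscopic side is `2^r` times the untwisted expansion:
`endoSideTw W = 2^r · endoSideUn W` ((19) summed against the stable terms). [folklore] (proved here)
[cite: Waldspurger2014StabilisationII, 4.3 l.2430, 4.2 l.2413, 1.12 l.990-992] -/
theorem endoSideTw_eq_two_pow_mul (W : SliceData r) (hγ : PairInvariance W) :
    endoSideTw W = (2 : ℂ) ^ r * endoSideUn W := by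
  unfold endoSideTw endoSideUn
  rw [Finset.mul_sum]
  refine Finset.sum_congr rfl fun t _ => ?_
  rw [hγ t, endoTw_eq_two_pow_mul_endoUn]
  push_cast
  ring

/-- §5 (29). THE TYPED REDUCTION, constant-free half: given [II] 4.2 (4) on `U(N)` (`MW42Def4`) and pair
invariance (26), the principal slice of [II] Thm 4.4 at [Mok]'s datum is EQUIVALENT to the single identity
`r^{G̃}_{M̃}(transfert(δ′), K̃) = 2^r · r^{U(N)}_{M′}(δ′, K)` ([II]'s measures) — all proper endoscopic terms cancel class by class ((α) on
classes, (β)), and the surviving factor is `|det(1-θ^{M̃}; 𝒜_M/(𝒜_{M̃}+𝒜_G))| = 2^r`.  This answers Q-UP-61-a's « if no, say which MW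
normalisation separates them »: yes up to (26) and the one constant of (27a).  [folklore] (proved here)
[cite: Waldspurger2014StabilisationII, 4.4 l.2436-2441, 4.3 l.2430, 4.2 l.2413, 1.12 l.984-992; Waldspurger2014StabilisationI, 3.3 l.1160-1163] -/
theorem mw44PrincipalSlice_iff (W : SliceData r) (h4 : MW42Def4 W) (hγ : PairInvariance W) :
    MW44PrincipalSlice W ↔ W.rTw = (2 : ℂ) ^ r * W.rUn := by
  unfold MW44PrincipalSlice
  rw [endoSideTw_eq_two_pow_mul W hγ, ← h4]
  exact eq_comm

/-- §5 (30). THE TYPED EDGE “TWFL principal slice at inert unramified `v` ⟺ [Kt_1] §3”: under `MW42Def4`,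
`PairInvariance` (26) and `Normalisation` (27a), [II] Thm 4.4's principal slice at `G̃_{E/F}(N) ⊃ M̃`, `𝐌′` principal, is equivalent to
Kottwitz's 1986 unit matching `WO_{δθ}(f_E) = WO_γ(f)` (27).  The hypotheses are exactly the residue the cell does not adjudicate; no status
word changes (row L09 stays as M56 types it).  [folklore] (proved here) [cite: Waldspurger2014StabilisationII, 4.4 l.2436-2441; Kottwitz1986BaseChangeUnits, §3 p. 247-248] -/
theorem mw44PrincipalSlice_iff_kt1 (W : SliceData r) (h4 : MW42Def4 W) (hγ : PairInvariance W)
    (hδ : Normalisation W) : MW44PrincipalSlice W ↔ Kt1Sec3 W := by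
  rw [mw44PrincipalSlice_iff W h4 hγ]
  obtain ⟨c, hc, h1, h2⟩ := hδ
  unfold Kt1Sec3
  rw [h1, h2]
  constructor
  · intro h; exact mul_left_cancel₀ hc h
  · intro h; rw [h]

/-- §5 (28a). The untwisted expansion unfolded: `endoSideUn W = sUn(U(N)) + Σ_{t ≠ false} (1/2) · sUn t` — [II] 4.2 (4)
with `i = 1/2` at every proper elliptic `G′(s) = U(N₁) × U(N₂)` ([II] 1.10). [folklore] (proved here)
[cite: Waldspurger2014StabilisationII, 4.2 l.2413, 1.10 l.736-737] -/
theorem endoSideUn_eq (W : SliceData r) :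
    endoSideUn W = W.sUn (fun _ => false) + ∑ t ∈ (Finset.univ.erase (fun _ => false)), (1 / 2 : ℂ) * W.sUn t := by
  unfold endoSideUn
  rw [← Finset.add_sum_erase Finset.univ _ (Finset.mem_univ (fun _ : Fin r => false))]
  congr 1
  · rw [endoUn_eq, coef, if_pos rfl]; push_cast; ring
  · refine Finset.sum_congr rfl fun t ht => ?_
    rw [Finset.mem_erase] at ht
    rw [endoUn_eq, coef, if_neg ht.1]
    push_cast; ring

end Statements

end Literature.NumberTheory.Automorphic.Arthur2013.Leaves.TwistedPrincipalSlice
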